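import Literature.Analysis.FluidPDE.SteadyNSRingCorrector
import Literature.Analysis.FluidPDE.SelfSimilar
import Literature.Analysis.FluidPDE.ParabolicLocalEstimatesProofs
import HarnessLib

/-!
# Caccioppoli's inequality for smooth steady solutions of the Navier–Stokes equations on `ℝ³`

Analysis/FluidPDE support file (everything proved; no named facts) on the discharge path of the
named fact `Literature.Analysis.FluidPDE.SereginWang2020_annular_liouville`
(`SteadyLiouvilleCriteria.lean`): Seregin–Wang 2020, **Proposition 2.1** (the Caccioppoli type
inequality (2.1)) for smooth solutions of `−νΔU + (U·∇)U + ∇P = 0`, `div U = 0`, in the instance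
of the Lebesgue norms `L²`, `L³` on the annulus and with cubes in place of balls:

  `ν ∫_{cube R/2} |∇U|² ≤ C (ν R⁻² ∫_{A_R} |U|² + R⁻¹ ∫_{A_R} |U|³)`,
  `A_R = {R/2 ≤ maxᵢ|xᵢ| ≤ 4R/7} ⊆ B_R ∖ B_{R/2}`  (`SteadyCaccioppoli.caccioppoli`).

The proof is the printed one: for `R/2 ≤ ρ < r ≤ 4R/7` a cut-off `φ` (here the product cut-off
`SteadyCaccioppoli.cutoff` on cubes), the corrector `w` with `div w = ∇φ·U` supported in the
shell (here the tree's `RingCorrector.ringCorrector` of `SteadyNSRingCorrector` in place of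
Bogovskiĭ's operator), the test field `φU − w`, which is divergence free so that the pressure
drops out (`SteadyCaccioppoli.energy_identity`, from the whole-space integration by parts of
`WholeSpaceIBP`), the estimates of the four terms `I₁, …, I₄` by Young's inequality and by the
`L²`/`L³` bounds of `Dw` (`term1_le` … `term4_le`), and the standard iteration
(`absorb_of_le_mul_add_div_pow` of `ParabolicLocalEstimatesProofs`).

## References

* G. Seregin, W. Wang, *Sufficient conditions on Liouville type theorems for the 3D steady
  Navier–Stokes equations*, St. Petersburg Math. J. 31 (2020) 387–393 = arXiv:1805.02227,
  Prop. 2.1 and its proof. [SereginWang2020]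
* M. Giaquinta, *Multiple integrals in the calculus of variations and nonlinear elliptic
  systems* (1983), Ch. V, Lemma 3.1 (the iteration lemma).
-/

noncomputable section

open MeasureTheory Set Filter Topology Function Metric intervalIntegral
open scoped RealInnerProductSpace ContDiff NNReal ENNReal

namespace Literature.Analysis.FluidPDE

open RingCorrector

namespace SteadyCaccioppoli

open CubeShell RingCorrector

/-- Local notation for physical space `ℝ³ = EuclideanSpace ℝ (Fin 3)`. -/
local notation "ℝ³" => EuclideanSpace ℝ (Fin 3)

/-! ### One-dimensional plateau functions -/

section Plateau

variable {ρ d : ℝ}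

/-- The decreasing smooth step `S = 1 − step (ρ + 3d/8) (d/4)`: `1` for `t ≤ ρ + d/4`, `0` for
`t ≥ ρ + d/2`. [folklore] -/
def Sdown (ρ d : ℝ) (t : ℝ) : ℝ := 1 - step (ρ + 3 * d / 8) (d / 4) t

/-- The even plateau `χ(t) = S(t) S(−t)`: `1` on `|t| ≤ ρ + d/4`, `0` off `|t| < ρ + d/2`.
[folklore] -/
def χ (ρ d : ℝ) (t : ℝ) : ℝ := Sdown ρ d t * Sdown ρ d (-t)

/-- Auxiliary (theorem `Sdown_contDiff`): Sdown contDiff. [folklore] -/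
theorem Sdown_contDiff {n : ℕ∞} : ContDiff ℝ n (Sdown ρ d) := contDiff_const.sub (step_contDiff _ _)

/-- Auxiliary (theorem `χ_contDiff`): χ contDiff. [folklore] -/
theorem χ_contDiff {n : ℕ∞} : ContDiff ℝ n (χ ρ d) :=
  Sdown_contDiff.mul (Sdown_contDiff.comp contDiff_neg)

/-- Auxiliary (theorem `Sdown_nonneg`): Sdown nonneg. [folklore] -/
theorem Sdown_nonneg (hd : 0 < d) (t : ℝ) : 0 ≤ Sdown ρ d t := by
  rw [Sdown, sub_nonneg]; exact step_le_one (by positivity) t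

/-- Auxiliary (theorem `Sdown_le_one`): Sdown le one. [folklore] -/
theorem Sdown_le_one (hd : 0 < d) (t : ℝ) : Sdown ρ d t ≤ 1 := by
  rw [Sdown, sub_le_self_iff]; exact step_nonneg (by positivity) t

/-- Auxiliary (theorem `Sdown_eq_one`): Sdown eq one. [folklore] -/
theorem Sdown_eq_one (hd : 0 < d) {t : ℝ} (ht : t ≤ ρ + d / 4) : Sdown ρ d t = 1 := by
  rw [Sdown, step_eq_zero (by positivity) (by linarith), sub_zero]

/-- Auxiliary (theorem `Sdown_eq_zero`): Sdown eq zero. [folklore] -/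
theorem Sdown_eq_zero (hd : 0 < d) {t : ℝ} (ht : ρ + d / 2 ≤ t) : Sdown ρ d t = 0 := by
  rw [Sdown, step_eq_one (by positivity) (by linarith), sub_self]

/-- Auxiliary (theorem `χ_nonneg`): χ nonneg. [folklore] -/
theorem χ_nonneg (hd : 0 < d) (t : ℝ) : 0 ≤ χ ρ d t := mul_nonneg (Sdown_nonneg hd t) (Sdown_nonneg hd _)

/-- Auxiliary (theorem `χ_le_one`): χ le one. [folklore] -/
theorem χ_le_one (hd : 0 < d) (t : ℝ) : χ ρ d t ≤ 1 := by
  rw [χ]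
  calc Sdown ρ d t * Sdown ρ d (-t) ≤ 1 * 1 :=
        mul_le_mul (Sdown_le_one hd t) (Sdown_le_one hd _) (Sdown_nonneg hd _) zero_le_one
    _ = 1 := one_mul _

/-- Auxiliary (theorem `abs_χ_le_one`): abs χ le one. [folklore] -/
theorem abs_χ_le_one (hd : 0 < d) (t : ℝ) : |χ ρ d t| ≤ 1 := by
  rw [abs_of_nonneg (χ_nonneg hd t)]; exact χ_le_one hd t

/-- Auxiliary (theorem `χ_eq_one`): χ eq one. [folklore] -/
theorem χ_eq_one (hd : 0 < d) {t : ℝ} (ht : |t| ≤ ρ + d / 4) : χ ρ d t = 1 := by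
  rw [abs_le] at ht
  rw [χ, Sdown_eq_one hd ht.2, Sdown_eq_one hd (by linarith), one_mul]

/-- Auxiliary (theorem `χ_eq_zero`): χ eq zero. [folklore] -/
theorem χ_eq_zero (hd : 0 < d) {t : ℝ} (ht : ρ + d / 2 ≤ |t|) : χ ρ d t = 0 := by
  rcases le_abs'.1 ht with h | h
  · rw [χ, Sdown_eq_zero hd (t := -t) (by linarith), mul_zero]
  · rw [χ, Sdown_eq_zero hd h, zero_mul]

/-- Auxiliary (theorem `hasDerivAt_Sdown`): hasDerivAt Sdown. [folklore] -/
theorem hasDerivAt_Sdown (t : ℝ) : HasDerivAt (Sdown ρ d) (-bump (ρ + 3 * d / 8) (d / 4) t) t :=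
  (hasDerivAt_step (ρ + 3 * d / 8) (d / 4) t).const_sub 1

/-- Auxiliary (theorem `abs_deriv_Sdown_le`): abs deriv Sdown le. [folklore] -/
theorem abs_deriv_Sdown_le (hd : 0 < d) (t : ℝ) : |deriv (Sdown ρ d) t| ≤ 4 * (B / d) := by
  rw [(hasDerivAt_Sdown t).deriv, abs_neg]
  refine (abs_bump_le (by positivity) t).trans (le_of_eq ?_)
  field_simp

/-- Auxiliary (theorem `abs_deriv_χ_le`): abs deriv χ le. [folklore] -/
theorem abs_deriv_χ_le (hd : 0 < d) (t : ℝ) : |deriv (χ ρ d) t| ≤ 8 * (B / d) := by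
  have h1 := hasDerivAt_Sdown (ρ := ρ) (d := d) t
  have h2 : HasDerivAt (fun s => Sdown ρ d (-s)) (-(-bump (ρ + 3 * d / 8) (d / 4) (-t))) t := by
    have h2' : HasDerivAt (fun s => Sdown ρ d (-s)) (-bump (ρ + 3 * d / 8) (d / 4) (-t) * -1) t :=
      (hasDerivAt_Sdown (ρ := ρ) (d := d) (-t)).comp t (hasDerivAt_neg t)
    exact h2'.congr_deriv (by ring)
  have h : HasDerivAt (χ ρ d) _ t := h1.mul h2
  rw [h.deriv]
  have b1 := abs_bump_le (c := ρ + 3 * d / 8) (by positivity : 0 < d / 4) t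
  have b2 := abs_bump_le (c := ρ + 3 * d / 8) (by positivity : 0 < d / 4) (-t)
  have s1 := abs_nonneg (Sdown ρ d t); have s2 := Sdown_nonneg hd (ρ := ρ) (-t)
  have s1' : |Sdown ρ d t| ≤ 1 := by rw [abs_of_nonneg (Sdown_nonneg hd t)]; exact Sdown_le_one hd t
  have s2' : |Sdown ρ d (-t)| ≤ 1 := by
    rw [abs_of_nonneg (Sdown_nonneg hd _)]; exact Sdown_le_one hd _
  have e : B / (d / 4) = 4 * (B / d) := by field_simp
  have hB4 : 0 ≤ 4 * (B / d) := by have := B_pos; positivity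
  rw [e] at b1 b2
  calc |(-bump (ρ + 3 * d / 8) (d / 4) t) * Sdown ρ d (-t) +
        Sdown ρ d t * -(-bump (ρ + 3 * d / 8) (d / 4) (-t))|
      ≤ |(-bump (ρ + 3 * d / 8) (d / 4) t) * Sdown ρ d (-t)| +
        |Sdown ρ d t * -(-bump (ρ + 3 * d / 8) (d / 4) (-t))| := abs_add_le _ _
    _ = |bump (ρ + 3 * d / 8) (d / 4) t| * |Sdown ρ d (-t)| +
        |Sdown ρ d t| * |bump (ρ + 3 * d / 8) (d / 4) (-t)| := by
        rw [abs_mul, abs_mul, abs_neg, neg_neg]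
    _ ≤ (4 * (B / d)) * 1 + 1 * (4 * (B / d)) := by
        gcongr
    _ = 8 * (B / d) := by ring

end Plateau

/-! ### The cut-off on cubes -/

section Cutoff

variable {ρ d : ℝ}

/-- The cubical cut-off `φ(x) = χ(x₀) χ(x₁) χ(x₂)`: smooth, `0 ≤ φ ≤ 1`, `φ = 1` on the cube of
half-width `ρ + d/4` (⊇ `cube ρ`), `φ = 0` off the cube of half-width `ρ + d/2`, `‖Dφ‖ ≤ 24B/d`.
[folklore] -/
def cutoff (ρ d : ℝ) (x : ℝ³) : ℝ := χ ρ d (x 0) * χ ρ d (x 1) * χ ρ d (x 2)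

/-- Auxiliary (theorem `cutoff_contDiff`): cutoff contDiff. [folklore] -/
theorem cutoff_contDiff {n : ℕ∞} : ContDiff ℝ n (cutoff ρ d) :=
  ((contDiff_comp_coord χ_contDiff 0).mul (contDiff_comp_coord χ_contDiff 1)).mul
    (contDiff_comp_coord χ_contDiff 2)

/-- Auxiliary (theorem `cutoff_nonneg`): cutoff nonneg. [folklore] -/
theorem cutoff_nonneg (hd : 0 < d) (x : ℝ³) : 0 ≤ cutoff ρ d x :=
  mul_nonneg (mul_nonneg (χ_nonneg hd _) (χ_nonneg hd _)) (χ_nonneg hd _)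

/-- Auxiliary (theorem `cutoff_le_one`): cutoff le one. [folklore] -/
theorem cutoff_le_one (hd : 0 < d) (x : ℝ³) : cutoff ρ d x ≤ 1 := by
  rw [cutoff]
  have h0 := χ_nonneg hd (ρ := ρ) (x 0); have h1 := χ_nonneg hd (ρ := ρ) (x 1)
  have h2 := χ_nonneg hd (ρ := ρ) (x 2)
  calc χ ρ d (x 0) * χ ρ d (x 1) * χ ρ d (x 2) ≤ 1 * 1 * 1 := by
        gcongr <;> first | exact mul_nonneg h0 h1 |>.trans_eq' rfl |>.le | exact χ_le_one hd _
    _ = 1 := by ring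

/-- Auxiliary (theorem `cutoff_eq_one`): cutoff eq one. [folklore] -/
theorem cutoff_eq_one (hd : 0 < d) {x : ℝ³} (hx : ∀ i, |x i| ≤ ρ + d / 4) : cutoff ρ d x = 1 := by
  rw [cutoff, χ_eq_one hd (hx 0), χ_eq_one hd (hx 1), χ_eq_one hd (hx 2)]; ring

/-- Auxiliary (theorem `cutoff_eq_zero`): cutoff eq zero. [folklore] -/
theorem cutoff_eq_zero (hd : 0 < d) {x : ℝ³} {i : Fin 3} (hx : ρ + d / 2 ≤ |x i|) :
    cutoff ρ d x = 0 := by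
  rw [cutoff]
  rcases fin3_cases i with rfl | rfl | rfl
  · rw [χ_eq_zero hd hx]; ring
  · rw [χ_eq_zero hd hx]; ring
  · rw [χ_eq_zero hd hx]; ring

/-- Auxiliary (theorem `cutoff_eq_zero_of_notMem`): cutoff eq zero of notMem. [folklore] -/
theorem cutoff_eq_zero_of_notMem (hd : 0 < d) {x : ℝ³} (hx : x ∉ cube (ρ + d / 2)) :
    cutoff ρ d x = 0 := by
  rw [mem_cube, not_forall] at hx
  obtain ⟨i, hi⟩ := hx
  exact cutoff_eq_zero hd (not_le.1 hi).le

/-- Auxiliary (theorem `tsupport_cutoff_subset`): tsupport cutoff subset. [folklore] -/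
theorem tsupport_cutoff_subset (hd : 0 < d) : tsupport (cutoff ρ d) ⊆ cube (ρ + d / 2) :=
  closure_minimal (fun x hx => by by_contra h; exact hx (cutoff_eq_zero_of_notMem hd h))
    (isClosed_cube _)

/-- Auxiliary (theorem `hasCompactSupport_cutoff`): hasCompactSupport cutoff. [folklore] -/
theorem hasCompactSupport_cutoff (hd : 0 < d) : HasCompactSupport (cutoff ρ d) :=
  (isCompact_cube _).of_isClosed_subset isClosed_closure (tsupport_cutoff_subset hd)

/-- The open inner cube on which `φ ≡ 1`. [folklore] -/
theorem isOpen_innerCube : IsOpen {y : ℝ³ | ∀ i, |y i| < ρ + d / 4} := by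
  have : {y : ℝ³ | ∀ i, |y i| < ρ + d / 4} = ⋂ i, {y : ℝ³ | |y i| < ρ + d / 4} := by ext; simp
  rw [this]
  exact isOpen_iInter_of_finite fun i =>
    isOpen_lt (continuous_abs.comp (continuous_coord i)) continuous_const

/-- `Dφ = 0` on the open inner cube. [folklore] -/
theorem fderiv_cutoff_eq_zero (hd : 0 < d) {x : ℝ³} (hx : ∀ i, |x i| < ρ + d / 4) :
    fderiv ℝ (cutoff ρ d) x = 0 := by
  have h : cutoff ρ d =ᶠ[𝓝 x] fun _ => (1 : ℝ) := by
    filter_upwards [isOpen_innerCube.mem_nhds hx] with y hy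
    exact cutoff_eq_one hd fun i => (hy i).le
  rw [h.fderiv_eq, fderiv_const_apply]

/-- **`‖Dφ‖ ≤ 24B/d`.** [folklore] -/
theorem norm_fderiv_cutoff_le (hd : 0 < d) (x : ℝ³) : ‖fderiv ℝ (cutoff ρ d) x‖ ≤ 24 * (B / d) := by
  have hχd : Differentiable ℝ (χ ρ d) := χ_contDiff (n := 1) |>.differentiable (by simp)
  have hχ : ContDiff ℝ ∞ (χ ρ d) := χ_contDiff
  have d0 := dAt (contDiff_comp_coord hχ 0) x
  have d1 := dAt (contDiff_comp_coord hχ 1) x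
  have d2 := dAt (contDiff_comp_coord hχ 2) x
  have h01 := norm_fderiv_mul_le d0 d1
  have h012 := norm_fderiv_mul_le (d0.mul d1) d2
  have n0 := (norm_fderiv_comp_coord_le hχd 0 x).trans (abs_deriv_χ_le (ρ := ρ) hd (x 0))
  have n1 := (norm_fderiv_comp_coord_le hχd 1 x).trans (abs_deriv_χ_le (ρ := ρ) hd (x 1))
  have n2 := (norm_fderiv_comp_coord_le hχd 2 x).trans (abs_deriv_χ_le (ρ := ρ) hd (x 2))
  have a0 := abs_χ_le_one hd (ρ := ρ) (x 0); have a1 := abs_χ_le_one hd (ρ := ρ) (x 1)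
  have a2 := abs_χ_le_one hd (ρ := ρ) (x 2)
  have hB : 0 ≤ 8 * (B / d) := by have := B_pos; positivity
  change ‖fderiv ℝ (fun y => χ ρ d (y 0) * χ ρ d (y 1) * χ ρ d (y 2)) x‖ ≤ _
  have h01' : ‖fderiv ℝ (fun y => χ ρ d (y 0) * χ ρ d (y 1)) x‖ ≤ 16 * (B / d) := by
    refine h01.trans ?_
    have p1 : |χ ρ d (x 0)| * ‖fderiv ℝ (fun y : ℝ³ => χ ρ d (y 1)) x‖ ≤ 1 * (8 * (B / d)) :=
      mul_le_mul a0 n1 (norm_nonneg _) zero_le_one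
    have p2 : |χ ρ d (x 1)| * ‖fderiv ℝ (fun y : ℝ³ => χ ρ d (y 0)) x‖ ≤ 1 * (8 * (B / d)) :=
      mul_le_mul a1 n0 (norm_nonneg _) zero_le_one
    linarith
  have h012' : ‖fderiv ℝ (fun y => χ ρ d (y 0) * χ ρ d (y 1) * χ ρ d (y 2)) x‖ ≤
      |χ ρ d (x 0) * χ ρ d (x 1)| * ‖fderiv ℝ (fun y : ℝ³ => χ ρ d (y 2)) x‖ +
      |χ ρ d (x 2)| * ‖fderiv ℝ (fun y => χ ρ d (y 0) * χ ρ d (y 1)) x‖ := h012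
  refine h012'.trans ?_
  have hab : |χ ρ d (x 0) * χ ρ d (x 1)| ≤ 1 := by
    rw [abs_mul]; exact (mul_le_mul a0 a1 (abs_nonneg _) zero_le_one).trans_eq (one_mul _)
  have p1 : |χ ρ d (x 0) * χ ρ d (x 1)| * ‖fderiv ℝ (fun y : ℝ³ => χ ρ d (y 2)) x‖ ≤ 1 * (8 * (B / d)) :=
    mul_le_mul hab n2 (norm_nonneg _) zero_le_one
  have p2 : |χ ρ d (x 2)| * ‖fderiv ℝ (fun y => χ ρ d (y 0) * χ ρ d (y 1)) x‖ ≤ 1 * (16 * (B / d)) :=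
    mul_le_mul a2 h01' (norm_nonneg _) zero_le_one
  linarith

/-- Auxiliary (theorem `fderiv_cutoff_eq_zero_of_notMem_tsupport`): fderiv cutoff eq zero of notMem tsupport. [folklore] -/
theorem fderiv_cutoff_eq_zero_of_notMem_tsupport {x : ℝ³} (hx : x ∉ tsupport (cutoff ρ d)) :
    fderiv ℝ (cutoff ρ d) x = 0 :=
  fderiv_of_notMem_tsupport ℝ hx

end Cutoff

/-! ### The localised energy identity for smooth steady solutions -/

section EnergyIdentity

open InnerProductSpace
open scoped Laplacian

variable {ν : ℝ} {U : ℝ³ → ℝ³} {P : ℝ³ → ℝ} {φ : ℝ³ → ℝ} {w : ℝ³ → ℝ³}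

/-- `⟪U, ∇φ⟫ = Dφ[U]`. [folklore] -/
theorem inner_gradient_eq_fderiv (φ : ℝ³ → ℝ) (x v : ℝ³) : ⟪v, gradient φ x⟫ = fderiv ℝ φ x v := by
  rw [gradient, real_inner_comm, toDual_symm_apply]

/-- The steady equation rearranged: `ν ΔU = (U·∇)U + ∇P`. [folklore] -/
theorem steady_eq (hUP : IsLerayProfile ν 0 U P) (x : ℝ³) :
    ν • (Δ U) x = convect U U x + gradient P x := by
  have h := hUP.profile_eq x
  simp only [zero_smul, add_zero] at h
  -- h : -(ν • Δ U x) + convect U U x + gradient P x = 0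
  have : ν • (Δ U) x = -(-(ν • (Δ U) x) + convect U U x + gradient P x) + (convect U U x + gradient P x) := by
    abel
  rw [this, h, neg_zero, zero_add]

/-- Divergence of a difference (bookkeeping). [folklore] -/
theorem divergence_sub' {u v : ℝ³ → ℝ³} {x : ℝ³} (hu : DifferentiableAt ℝ u x)
    (hv : DifferentiableAt ℝ v x) :
    VectorCalculus.divergence (fun y => u y - v y) x =
      VectorCalculus.divergence u x - VectorCalculus.divergence v x := by
  simp only [VectorCalculus.divergence, fderiv_fun_sub hu hv, ContinuousLinearMap.toLinearMap_sub, map_sub]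

/-- Integrability of `⟪F, ψ⟫` for continuous `F` and continuous compactly supported `ψ`. [folklore] -/
theorem integrable_inner_right {F ψ : ℝ³ → ℝ³} (hF : Continuous F) (hψ : Continuous ψ)
    (hψc : HasCompactSupport ψ) : Integrable fun x => ⟪F x, ψ x⟫ :=
  (hF.inner hψ).integrable_of_hasCompactSupport
    (hψc.mono fun x hx => by contrapose! hx; simp_all)

/-- Auxiliary (theorem `integrable_inner_left`): integrable inner left. [folklore] -/
theorem integrable_inner_left {F ψ : ℝ³ → ℝ³} (hψ : Continuous ψ) (hψc : HasCompactSupport ψ)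
    (hF : Continuous F) : Integrable fun x => ⟪ψ x, F x⟫ := by
  have := integrable_inner_right hF hψ hψc
  simpa only [real_inner_comm] using this

/-- **The localised energy identity.** For a `C²` steady solution (`IsLerayProfile ν 0 U P`),
a smooth compactly supported cut-off `φ` and a `C¹` compactly supported corrector `w` with
`div w = Dφ[U]`, testing the equation with the divergence-free field `ψ = φU − w` gives
`ν ∫ φ |∇U|² = −ν Σᵢ ∫ ∂ᵢφ ⟪∂ᵢU, U⟫ + ν Σᵢ ∫ ⟪∂ᵢU, ∂ᵢw⟫ + ½ ∫ Dφ[U] |U|² − ∫ ⟪U, Dw[U]⟫`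
(Seregin–Wang 2020, proof of Prop. 2.1: "Multiplication of both sides of the equation by
`(φu − w)` and integration by parts give `∫φ|∇u|² = I₁ + ⋯ + I₄`"). [cite: SereginWang2020, proof of Prop. 2.1 (I₁+…+I₄)] -/
theorem energy_identity (hUP : IsLerayProfile ν 0 U P) (hφ : ContDiff ℝ ∞ φ)
    (hφc : HasCompactSupport φ) (hw : ContDiff ℝ 1 w) (hwc : HasCompactSupport w)
    (hdiv : ∀ x, VectorCalculus.divergence w x = fderiv ℝ φ x (U x)) :
    ν * (∫ x, φ x * ∑ i, ‖fderiv ℝ U x (e i)‖ ^ 2) =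
      -(ν * ∑ i, ∫ x, fderiv ℝ φ x (e i) * ⟪fderiv ℝ U x (e i), U x⟫)
      + ν * (∑ i, ∫ x, ⟪fderiv ℝ U x (e i), fderiv ℝ w x (e i)⟫)
      + (1 / 2) * (∫ x, fderiv ℝ φ x (U x) * ‖U x‖ ^ 2)
      - ∫ x, ⟪U x, fderiv ℝ w x (U x)⟫ := by
  -- regularity
  have hU2 : ContDiff ℝ 2 U := hUP.contDiff_velocity
  have hU1 : ContDiff ℝ 1 U := hU2.of_le one_le_two
  have hP1 : ContDiff ℝ 1 P := hUP.contDiff_pressure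
  have hφ1 : ContDiff ℝ 1 φ := hφ.of_le (by simp)
  have hUc : Continuous U := hU2.continuous
  have hDUc : Continuous (fderiv ℝ U) := hU2.continuous_fderiv (by simp)
  have hDUi : ∀ i, Continuous fun x => fderiv ℝ U x (e i) := fun i => hDUc.clm_apply continuous_const
  have hφcont : Continuous φ := hφ.continuous
  have hDφc : Continuous (fderiv ℝ φ) := hφ.continuous_fderiv (by simp)
  have hwcont : Continuous w := hw.continuous
  have hDwc : Continuous (fderiv ℝ w) := hw.continuous_fderiv (by simp)
  have hdU : ∀ x, DifferentiableAt ℝ U x := fun x => hU1.differentiable (by simp) x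
  have hdφ : ∀ x, DifferentiableAt ℝ φ x := fun x => hφ1.differentiable (by simp) x
  have hdw : ∀ x, DifferentiableAt ℝ w x := fun x => hw.differentiable (by simp) x
  -- the test field
  set ψ : ℝ³ → ℝ³ := fun x => φ x • U x - w x with hψdef
  have hφU1 : ContDiff ℝ 1 fun x => φ x • U x := hφ1.smul hU1
  have hφUc : HasCompactSupport fun x => φ x • U x := hφc.smul_right
  have hψ1 : ContDiff ℝ 1 ψ := hφU1.sub hw
  have hψc : HasCompactSupport ψ := hφUc.sub hwc
  have hψcont : Continuous ψ := hψ1.continuous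
  have hdivψ : ∀ x, VectorCalculus.divergence ψ x = 0 := fun x => by
    rw [hψdef, divergence_sub' (hφU1.differentiable (by simp) x) (hdw x),
      divergence_smul_apply (hdφ x) (hdU x), hUP.divFree x, hdiv x, inner_gradient_eq_fderiv]
    ring
  have hDψ : ∀ x v, fderiv ℝ ψ x v = φ x • fderiv ℝ U x v + fderiv ℝ φ x v • U x - fderiv ℝ w x v := by
    intro x v
    have h : HasFDerivAt ψ (φ x • fderiv ℝ U x + (fderiv ℝ φ x).smulRight (U x) - fderiv ℝ w x) x :=
      ((hdφ x).hasFDerivAt.smul (hdU x).hasFDerivAt).sub (hdw x).hasFDerivAt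
    rw [h.fderiv]
    simp only [sub_apply, add_apply, smul_apply, ContinuousLinearMap.smulRight_apply]
  -- (iii) the tested equation
  have h3 : ν * (∫ x, ⟪(Δ U) x, ψ x⟫) =
      (∫ x, ⟪convect U U x, ψ x⟫) + ∫ x, ⟪gradient P x, ψ x⟫ := by
    have j1 : Integrable fun x => ⟪convect U U x, ψ x⟫ :=
      integrable_inner_right (hDUc.clm_apply hUc) hψcont hψc
    have j2 : Integrable fun x => ⟪gradient P x, ψ x⟫ :=
      integrable_inner_right (continuous_gradient_of_contDiff hP1) hψcont hψc
    have hpt : (fun x => ν * ⟪(Δ U) x, ψ x⟫) = fun x => ⟪convect U U x, ψ x⟫ + ⟪gradient P x, ψ x⟫ := by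
      funext x
      rw [← real_inner_smul_left, steady_eq hUP x, inner_add_left]
    rw [← MeasureTheory.integral_const_mul, hpt, integral_add j1 j2]
  -- (iv) Green
  have h4 : (∫ x, ⟪(Δ U) x, ψ x⟫) + (∑ i, ∫ x, ⟪fderiv ℝ U x (e i), fderiv ℝ ψ x (e i)⟫) = 0 := by
    have := integral_inner_laplacian_add_eq_zero (EuclideanSpace.basisFun (Fin 3) ℝ) hU2 hψ1 (Or.inr hψc)
    simpa only [basisFun_eq_e] using this
  -- (v) pressure
  have h5 : ∫ x, ⟪gradient P x, ψ x⟫ = 0 := by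
    rw [integral_inner_gradient_eq_neg_integral_mul_divergence hP1 hψ1 hψc]
    simp [hdivψ]
  -- (vi) expansion of the gradient pairing
  have h6 : ∀ i, ∫ x, ⟪fderiv ℝ U x (e i), fderiv ℝ ψ x (e i)⟫ =
      (∫ x, φ x * ‖fderiv ℝ U x (e i)‖ ^ 2) + (∫ x, fderiv ℝ φ x (e i) * ⟪fderiv ℝ U x (e i), U x⟫)
        - ∫ x, ⟪fderiv ℝ U x (e i), fderiv ℝ w x (e i)⟫ := by
    intro i
    have i1 : Integrable fun x => φ x * ‖fderiv ℝ U x (e i)‖ ^ 2 :=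
      (hφcont.mul ((hDUi i).norm.pow 2)).integrable_of_hasCompactSupport hφc.mul_right
    have i2 : Integrable fun x => fderiv ℝ φ x (e i) * ⟪fderiv ℝ U x (e i), U x⟫ :=
      ((hDφc.clm_apply continuous_const).mul ((hDUi i).inner hUc)).integrable_of_hasCompactSupport
        ((hφc.fderiv_apply (𝕜 := ℝ) (e i)).mul_right)
    have i3 : Integrable fun x => ⟪fderiv ℝ U x (e i), fderiv ℝ w x (e i)⟫ :=
      integrable_inner_right (hDUi i) (hDwc.clm_apply continuous_const) (hwc.fderiv_apply (𝕜 := ℝ) (e i))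
    have i12 : Integrable fun x => φ x * ‖fderiv ℝ U x (e i)‖ ^ 2 +
        fderiv ℝ φ x (e i) * ⟪fderiv ℝ U x (e i), U x⟫ := i1.add i2
    have hfun : (fun x => ⟪fderiv ℝ U x (e i), fderiv ℝ ψ x (e i)⟫) = fun x =>
        (φ x * ‖fderiv ℝ U x (e i)‖ ^ 2 + fderiv ℝ φ x (e i) * ⟪fderiv ℝ U x (e i), U x⟫) -
        ⟪fderiv ℝ U x (e i), fderiv ℝ w x (e i)⟫ := by
      funext x
      rw [hDψ, inner_sub_right, inner_add_right, real_inner_smul_right, real_inner_smul_right,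
        real_inner_self_eq_norm_sq, mul_comm (fderiv ℝ φ x (e i))]
    rw [hfun, integral_sub i12 i3, integral_add i1 i2]
  -- (vii) the convection pairings
  have hdiv0 : ∀ x, VectorCalculus.divergence U x = 0 := hUP.divFree
  have h7a : (∫ x, ⟪convect U U x, φ x • U x⟫) = -(1 / 2) * ∫ x, fderiv ℝ φ x (U x) * ‖U x‖ ^ 2 := by
    have T := integral_inner_convect_add_eq_zero (u := U) (v := U) (w := fun x => φ x • U x) hU1 hU1 hφU1 hφUc
    have hz : ∫ x, VectorCalculus.divergence U x * ⟪U x, φ x • U x⟫ = 0 := by simp [hdiv0]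
    rw [hz, add_zero] at T
    have e1 : (∫ x, ⟪U x, convect U (fun y => φ y • U y) x⟫) =
        (∫ x, fderiv ℝ φ x (U x) * ‖U x‖ ^ 2) + ∫ x, ⟪convect U U x, φ x • U x⟫ := by
      have j1 : Integrable fun x => fderiv ℝ φ x (U x) * ‖U x‖ ^ 2 :=
        ((hDφc.clm_apply hUc).mul (hUc.norm.pow 2)).integrable_of_hasCompactSupport
          ((hφc.fderiv (𝕜 := ℝ)).mono (fun x hx => by
            contrapose! hx; simp only [mem_support, not_not] at hx ⊢; simp [hx])).mul_right
      have j2 : Integrable fun x => ⟪convect U U x, φ x • U x⟫ :=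
        integrable_inner_right (hDUc.clm_apply hUc) (hφcont.smul hUc) hφUc
      rw [← integral_add j1 j2]
      refine integral_congr_ae (Eventually.of_forall fun x => ?_)
      dsimp only
      rw [convect_smul_apply (hdφ x) (hdU x)]
      simp only [convect_apply, inner_add_right, real_inner_smul_right, real_inner_self_eq_norm_sq]
      rw [real_inner_comm (U x)]
      ring
    rw [e1] at T
    linarith
  have h7b : (∫ x, ⟪convect U U x, w x⟫) = -∫ x, ⟪U x, fderiv ℝ w x (U x)⟫ := by
    have T := integral_inner_convect_add_eq_zero (u := U) (v := U) (w := w) hU1 hU1 hw hwc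
    have hz : ∫ x, VectorCalculus.divergence U x * ⟪U x, w x⟫ = 0 := by simp [hdiv0]
    rw [hz, add_zero] at T
    simp only [convect] at T ⊢
    linarith
  have h7 : (∫ x, ⟪convect U U x, ψ x⟫) =
      -(1 / 2) * (∫ x, fderiv ℝ φ x (U x) * ‖U x‖ ^ 2) + ∫ x, ⟪U x, fderiv ℝ w x (U x)⟫ := by
    have j2 : Integrable fun x => ⟪convect U U x, φ x • U x⟫ :=
      integrable_inner_right (hDUc.clm_apply hUc) (hφcont.smul hUc) hφUc
    have j3 : Integrable fun x => ⟪convect U U x, w x⟫ :=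
      integrable_inner_right (hDUc.clm_apply hUc) hwcont hwc
    have : (∫ x, ⟪convect U U x, ψ x⟫) = (∫ x, ⟪convect U U x, φ x • U x⟫) - ∫ x, ⟪convect U U x, w x⟫ := by
      rw [← integral_sub j2 j3]
      refine integral_congr_ae (Eventually.of_forall fun x => ?_)
      rw [hψdef]; simp only [inner_sub_right]
    rw [this, h7a, h7b]
    ring
  -- (viii) combine
  have hsum : (∑ i, ∫ x, ⟪fderiv ℝ U x (e i), fderiv ℝ ψ x (e i)⟫) =
      (∫ x, φ x * ∑ i, ‖fderiv ℝ U x (e i)‖ ^ 2) +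
      (∑ i, ∫ x, fderiv ℝ φ x (e i) * ⟪fderiv ℝ U x (e i), U x⟫) -
      (∑ i, ∫ x, ⟪fderiv ℝ U x (e i), fderiv ℝ w x (e i)⟫) := by
    simp only [h6, Finset.sum_sub_distrib, Finset.sum_add_distrib]
    congr 2
    have iI : ∀ i, Integrable fun x => φ x * ‖fderiv ℝ U x (e i)‖ ^ 2 := fun i =>
      (hφcont.mul ((hDUi i).norm.pow 2)).integrable_of_hasCompactSupport hφc.mul_right
    rw [← integral_finsetSum _ (fun i _ => iI i)]
    refine integral_congr_ae (Eventually.of_forall fun x => ?_)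
    simp only [Finset.mul_sum]
  have key : ν * (∑ i, ∫ x, ⟪fderiv ℝ U x (e i), fderiv ℝ ψ x (e i)⟫) =
      (1 / 2) * (∫ x, fderiv ℝ φ x (U x) * ‖U x‖ ^ 2) - ∫ x, ⟪U x, fderiv ℝ w x (U x)⟫ := by
    have e4 : (∫ x, ⟪(Δ U) x, ψ x⟫) = -(∑ i, ∫ x, ⟪fderiv ℝ U x (e i), fderiv ℝ ψ x (e i)⟫) := by linarith
    have := h3
    rw [e4, h5, add_zero, h7] at this
    linarith
  rw [hsum] at key
  linarith

end EnergyIdentity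

/-! ### Elementary inequalities and `L^p` bookkeeping for the Caccioppoli estimate -/

section Elementary

/-- Young: `ab ≤ a²/4 + b²`. [folklore] -/
theorem young_two (a b : ℝ) : a * b ≤ a ^ 2 / 4 + b ^ 2 := by
  nlinarith [sq_nonneg (a / 2 - b)]

/-- Weighted AM–GM: `x²y ≤ (2L/3) x³ + y³/(3L²)` for `x, y ≥ 0`, `L > 0`
(from `2(Lx)³ + y³ − 3(Lx)²y = (Lx − y)²(2Lx + y) ≥ 0`). [folklore] -/
theorem young_three {x y L : ℝ} (hx : 0 ≤ x) (hy : 0 ≤ y) (hL : 0 < L) :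
    x ^ 2 * y ≤ 2 * L / 3 * x ^ 3 + y ^ 3 / (3 * L ^ 2) := by
  have key : 0 ≤ (L * x - y) ^ 2 * (2 * L * x + y) := by positivity
  have h3 : 3 * L ^ 2 * (x ^ 2 * y) ≤ 2 * L ^ 3 * x ^ 3 + y ^ 3 := by nlinarith [key]
  have hL2 : 0 < 3 * L ^ 2 := by positivity
  rw [show 2 * L / 3 * x ^ 3 + y ^ 3 / (3 * L ^ 2) = (2 * L ^ 3 * x ^ 3 + y ^ 3) / (3 * L ^ 2) by
    field_simp]
  rw [le_div_iff₀ hL2]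
  linarith

/-- `(x^{1/n})^n = x` bookkeeping: from an `eLpNorm` comparison to a comparison of `∫ ‖·‖ⁿ`.
[folklore] -/
theorem integral_pow_le_of_eLpNorm_le {G : Type*} [NormedAddCommGroup G] {g : ℝ³ → G} {f : ℝ³ → ℝ}
    {n : ℕ} (hn : 1 ≤ n) {C : ℝ} (hC : 0 ≤ C) (hg : MemLp g n volume) (hf : MemLp f n volume)
    (h : eLpNorm g n volume ≤ ENNReal.ofReal C * eLpNorm f n volume) :
    ∫ x, ‖g x‖ ^ n ≤ C ^ n * ∫ x, |f x| ^ n := by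
  have hn0 : (n : ℝ≥0∞) ≠ 0 := by exact_mod_cast (show n ≠ 0 by omega)
  have hnt : (n : ℝ≥0∞) ≠ ⊤ := ENNReal.natCast_ne_top n
  have hnr : ((n : ℝ≥0∞)).toReal = n := ENNReal.toReal_natCast n
  rw [hg.eLpNorm_eq_integral_rpow_norm hn0 hnt, hf.eLpNorm_eq_integral_rpow_norm hn0 hnt, hnr] at h
  simp only [Real.rpow_natCast, Real.norm_eq_abs] at h
  set Ig := ∫ x, ‖g x‖ ^ n with hIg
  set If := ∫ x, |f x| ^ n with hIf
  have hIg0 : 0 ≤ Ig := integral_nonneg fun x => by positivity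
  have hIf0 : 0 ≤ If := integral_nonneg fun x => by positivity
  rw [← ENNReal.ofReal_mul hC] at h
  have h2 : Ig ^ (n : ℝ)⁻¹ ≤ C * If ^ (n : ℝ)⁻¹ :=
    (ENNReal.ofReal_le_ofReal_iff (by positivity)).1 h
  have hn' : n ≠ 0 := by omega
  calc Ig = (Ig ^ (n : ℝ)⁻¹) ^ n := (Real.rpow_inv_natCast_pow hIg0 hn').symm
    _ ≤ (C * If ^ (n : ℝ)⁻¹) ^ n := pow_le_pow_left₀ (by positivity) h2 n
    _ = C ^ n * If := by rw [mul_pow, Real.rpow_inv_natCast_pow hIf0 hn']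

/-- `MemLp` of a continuous compactly supported function (bookkeeping). [folklore] -/
theorem memLp_of_continuous_hasCompactSupport {G : Type*} [NormedAddCommGroup G] {g : ℝ³ → G}
    (hg : Continuous g) (hgc : HasCompactSupport g) (p : ℝ≥0∞) : MemLp g p volume :=
  hg.memLp_of_hasCompactSupport hgc

end Elementary

/-! ### The Caccioppoli inequality on cubes -/

section Caccioppoli

open InnerProductSpace

/-- The pointwise squared gradient `Σᵢ ‖∂ᵢU‖²` (`= |∇U|²`). [folklore] -/
def gradSq (U : ℝ³ → ℝ³) (x : ℝ³) : ℝ := ∑ i, ‖fderiv ℝ U x (e i)‖ ^ 2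

/-- Auxiliary (theorem `gradSq_nonneg`): gradSq nonneg. [folklore] -/
theorem gradSq_nonneg (U : ℝ³ → ℝ³) (x : ℝ³) : 0 ≤ gradSq U x :=
  Finset.sum_nonneg fun _ _ => sq_nonneg _

/-- Auxiliary (theorem `gradSq_eq_frobeniusNormSq`): gradSq eq frobeniusNormSq. [folklore] -/
theorem gradSq_eq_frobeniusNormSq (U : ℝ³ → ℝ³) (x : ℝ³) :
    gradSq U x = frobeniusNormSq (fderiv ℝ U x) := by
  rw [gradSq, frobeniusNormSq_eq_sum (EuclideanSpace.basisFun (Fin 3) ℝ)]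
  simp only [basisFun_eq_e]

/-- Auxiliary (theorem `continuous_gradSq`): continuous gradSq. [folklore] -/
theorem continuous_gradSq {U : ℝ³ → ℝ³} (hU : ContDiff ℝ 1 U) : Continuous (gradSq U) := by
  unfold gradSq
  refine continuous_finsetSum _ fun i _ => ?_
  exact ((hU.continuous_fderiv (by simp)).clm_apply continuous_const).norm.pow 2

/-- Each `‖∂ᵢU‖² ≤ |∇U|²`. [folklore] -/
theorem sq_norm_fderiv_apply_le_gradSq (U : ℝ³ → ℝ³) (x : ℝ³) (i : Fin 3) :
    ‖fderiv ℝ U x (e i)‖ ^ 2 ≤ gradSq U x :=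
  Finset.single_le_sum (f := fun j => ‖fderiv ℝ U x (e j)‖ ^ 2) (fun _ _ => sq_nonneg _)
    (Finset.mem_univ i)

/-- The annular region on cubes: `A_R = {R/2 ≤ maxᵢ|xᵢ| ≤ 4R/7}`, inside `{R/2 ≤ |x| < R}`.
[folklore] -/
def cubeAnnulus (R : ℝ) : Set ℝ³ := shell (R / 2) (4 * R / 7)

/-- Auxiliary (theorem `isCompact_cubeAnnulus`): isCompact cubeAnnulus. [folklore] -/
theorem isCompact_cubeAnnulus (R : ℝ) : IsCompact (cubeAnnulus R) := isCompact_shell _ _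

/-- Auxiliary (theorem `measurableSet_cubeAnnulus`): measurableSet cubeAnnulus. [folklore] -/
theorem measurableSet_cubeAnnulus (R : ℝ) : MeasurableSet (cubeAnnulus R) :=
  (isClosed_shell _ _).measurableSet

/-- `A_R ⊆ B_R ∖ B_{R/2}`. [folklore] -/
theorem cubeAnnulus_subset {R : ℝ} (hR : 0 < R) :
    cubeAnnulus R ⊆ ball (0 : ℝ³) R \ ball 0 (R / 2) := by
  intro x hx
  obtain ⟨⟨i, hi⟩, hb⟩ := hx
  constructor
  · rw [mem_ball_zero_iff]
    have hsum : ∑ j, ‖x j‖ ^ 2 ≤ 3 * (4 * R / 7) ^ 2 := by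
      calc ∑ j, ‖x j‖ ^ 2 ≤ ∑ _j : Fin 3, (4 * R / 7) ^ 2 := Finset.sum_le_sum fun j _ => by
            rw [Real.norm_eq_abs]; exact pow_le_pow_left₀ (abs_nonneg _) (hb j) 2
        _ = 3 * (4 * R / 7) ^ 2 := by simp
    have h2 : ‖x‖ ^ 2 < R ^ 2 := by
      rw [EuclideanSpace.norm_eq, Real.sq_sqrt (Finset.sum_nonneg fun _ _ => by positivity)]
      nlinarith
    exact (abs_lt_of_sq_lt_sq' h2 hR.le).2
  · rw [mem_ball_zero_iff, not_lt]
    exact hi.trans (abs_coord_le_norm x i)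

end Caccioppoli

/-! ### The constants of the corrector in `L²` and `L³` -/

section Constants

/-- Auxiliary (theorem `exists_K2`): exists K2. [folklore] -/
theorem exists_K2 : ∃ K : ℝ, 0 < K ∧ ∀ (a b δ : ℝ) (f : ℝ³ → ℝ), Geometry a b δ f →
    eLpNorm (fun x => ‖fderiv ℝ (ringCorrector a b δ f) x‖) 2 volume ≤
      ENNReal.ofReal (K * (b / (b - a)) ^ 5 * (b / δ) ^ 4) * eLpNorm f 2 volume :=
  exists_eLpNorm_fderiv_ringCorrector_le (p := 2) (by norm_num) (by norm_num)

/-- Auxiliary (theorem `exists_K3`): exists K3. [folklore] -/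
theorem exists_K3 : ∃ K : ℝ, 0 < K ∧ ∀ (a b δ : ℝ) (f : ℝ³ → ℝ), Geometry a b δ f →
    eLpNorm (fun x => ‖fderiv ℝ (ringCorrector a b δ f) x‖) 3 volume ≤
      ENNReal.ofReal (K * (b / (b - a)) ^ 5 * (b / δ) ^ 4) * eLpNorm f 3 volume :=
  exists_eLpNorm_fderiv_ringCorrector_le (p := 3) (by norm_num) (by norm_num)

/-- The `L²` constant of the ring corrector. [folklore] -/
def K2 : ℝ := Classical.choose exists_K2

/-- The `L³` constant of the ring corrector. [folklore] -/
def K3 : ℝ := Classical.choose exists_K3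

/-- Auxiliary (theorem `K2_pos`): K2 pos. [folklore] -/
theorem K2_pos : 0 < K2 := (Classical.choose_spec exists_K2).1
/-- Auxiliary (theorem `K3_pos`): K3 pos. [folklore] -/
theorem K3_pos : 0 < K3 := (Classical.choose_spec exists_K3).1

/-- Auxiliary (theorem `K2_spec`): K2 spec. [folklore] -/
theorem K2_spec {a b δ : ℝ} {f : ℝ³ → ℝ} (G : Geometry a b δ f) :
    eLpNorm (fun x => ‖fderiv ℝ (ringCorrector a b δ f) x‖) 2 volume ≤
      ENNReal.ofReal (K2 * (b / (b - a)) ^ 5 * (b / δ) ^ 4) * eLpNorm f 2 volume :=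
  (Classical.choose_spec exists_K2).2 a b δ f G

/-- Auxiliary (theorem `K3_spec`): K3 spec. [folklore] -/
theorem K3_spec {a b δ : ℝ} {f : ℝ³ → ℝ} (G : Geometry a b δ f) :
    eLpNorm (fun x => ‖fderiv ℝ (ringCorrector a b δ f) x‖) 3 volume ≤
      ENNReal.ofReal (K3 * (b / (b - a)) ^ 5 * (b / δ) ^ 4) * eLpNorm f 3 volume :=
  (Classical.choose_spec exists_K3).2 a b δ f G

/-- Real form of the corrector bounds: `∫ ‖Dw‖ⁿ ≤ (Kₙ Q)ⁿ ∫ |f|ⁿ`, `n = 2, 3`. [folklore] -/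
theorem integral_pow_fderiv_ringCorrector_le {a b δ : ℝ} {f : ℝ³ → ℝ} (G : Geometry a b δ f) :
    (∫ x, ‖fderiv ℝ (ringCorrector a b δ f) x‖ ^ 2 ≤
      (K2 * (b / (b - a)) ^ 5 * (b / δ) ^ 4) ^ 2 * ∫ x, |f x| ^ 2) ∧
    (∫ x, ‖fderiv ℝ (ringCorrector a b δ f) x‖ ^ 3 ≤
      (K3 * (b / (b - a)) ^ 5 * (b / δ) ^ 4) ^ 3 * ∫ x, |f x| ^ 3) := by
  have hb := G.hb; have hℓ := G.hℓ; have hδ := G.hδ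
  have hw : ContDiff ℝ ∞ (ringCorrector a b δ f) := G.contDiff_ringCorrector
  have hgc : Continuous fun x => ‖fderiv ℝ (ringCorrector a b δ f) x‖ :=
    (hw.continuous_fderiv (by simp)).norm
  have hgs : HasCompactSupport fun x => ‖fderiv ℝ (ringCorrector a b δ f) x‖ :=
    (G.hasCompactSupport_ringCorrector.fderiv (𝕜 := ℝ)).norm
  have hfc : Continuous f := G.smooth.continuous
  have e : ∀ n : ℕ, (∫ x, ‖fderiv ℝ (ringCorrector a b δ f) x‖ ^ n) =
      ∫ x, ‖(fun y => ‖fderiv ℝ (ringCorrector a b δ f) y‖) x‖ ^ n := fun n => by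
    simp only [norm_norm]
  refine ⟨?_, ?_⟩
  · rw [e 2]
    exact integral_pow_le_of_eLpNorm_le (by norm_num) (by have := K2_pos; positivity)
      (memLp_of_continuous_hasCompactSupport hgc hgs 2) (memLp_of_continuous_hasCompactSupport hfc G.hfc 2)
      (by exact_mod_cast K2_spec G)
  · rw [e 3]
    exact integral_pow_le_of_eLpNorm_le (by norm_num) (by have := K3_pos; positivity)
      (memLp_of_continuous_hasCompactSupport hgc hgs 3) (memLp_of_continuous_hasCompactSupport hfc G.hfc 3)
      (by exact_mod_cast K3_spec G)

end Constants

/-! ### One step of the iteration -/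

section Step

open InnerProductSpace

variable {ν R ρ r : ℝ} {U : ℝ³ → ℝ³} {P : ℝ³ → ℝ}

/-- The data of one iteration step `R/2 ≤ ρ < r ≤ 4R/7`. [folklore] -/
structure StepData (ν R ρ r : ℝ) (U : ℝ³ → ℝ³) (P : ℝ³ → ℝ) : Prop where
  /-- Field `hν`. -/
  hν : 0 < ν
  /-- Field `hR`. -/
  hR : 0 < R
  /-- Field `hρ`. -/
  hρ : R / 2 ≤ ρ
  /-- Field `hρr`. -/
  hρr : ρ < r
  /-- Field `hr`. -/
  hr : r ≤ 4 * R / 7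
  /-- Field `profile`. -/
  profile : IsLerayProfile ν 0 U P
  /-- Field `smooth`. -/
  smooth : ContDiff ℝ ∞ U

namespace StepData

variable (s : StepData ν R ρ r U P)
include s

/-- Auxiliary (theorem `hd`): hd. [folklore] -/
theorem hd : 0 < r - ρ := sub_pos.2 s.hρr
/-- Auxiliary (theorem `hd14`): hd14. [folklore] -/
theorem hd14 : r - ρ ≤ R / 14 := by linarith [s.hρ, s.hr]
/-- Auxiliary (theorem `hdR`): hdR. [folklore] -/
theorem hdR : r - ρ ≤ R := by linarith [s.hd14, s.hR]
/-- Auxiliary (theorem `hρpos`): hρpos. [folklore] -/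
theorem hρpos : 0 < ρ := by linarith [s.hρ, s.hR]
/-- Auxiliary (theorem `hdρ`): hdρ. [folklore] -/
theorem hdρ : r - ρ ≤ ρ := by linarith [s.hd14, s.hρ, s.hR]
/-- Auxiliary (theorem `hρR`): hρR. [folklore] -/
theorem hρR : ρ ≤ 4 * R / 7 := by linarith [s.hρr, s.hr]

/-! #### The datum `f = Dφ[U]` -/

/-- The datum `f = Dφ[U]` of the corrector, `φ = cutoff ρ (r - ρ)`. [folklore] -/
def datum (ρ r : ℝ) (U : ℝ³ → ℝ³) (x : ℝ³) : ℝ := fderiv ℝ (cutoff ρ (r - ρ)) x (U x)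

/-- Auxiliary (theorem `datum_contDiff`): datum contDiff. [folklore] -/
theorem datum_contDiff : ContDiff ℝ ∞ (datum ρ r U) :=
  ((cutoff_contDiff (ρ := ρ) (d := r - ρ) (n := ⊤)).fderiv_right (m := ∞) (by simp)).clm_apply s.smooth

/-- `|f| ≤ 24B/(r-ρ) · |U|`. [folklore] -/
theorem abs_datum_le (x : ℝ³) : |datum ρ r U x| ≤ 24 * (B / (r - ρ)) * ‖U x‖ := by
  rw [datum, ← Real.norm_eq_abs]
  exact (ContinuousLinearMap.le_opNorm _ _).trans
    (mul_le_mul_of_nonneg_right (norm_fderiv_cutoff_le s.hd x) (norm_nonneg _))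

/-- `f = 0` off the shell `S(ρ + d/4, ρ + d/2)`. [folklore] -/
theorem datum_eq_zero {x : ℝ³}
    (hx : x ∉ shell (ρ + (r - ρ) / 8 + (r - ρ) / 8) (ρ + 5 * (r - ρ) / 8 - (r - ρ) / 8)) :
    datum ρ r U x = 0 := by
  rw [datum]
  rcases not_mem_shell.1 hx with h | ⟨i, hi⟩
  · rw [fderiv_cutoff_eq_zero s.hd (fun i => by have := h i; linarith), zero_apply]
  · have hx' : x ∉ tsupport (cutoff ρ (r - ρ)) := fun h' => by
      have := (tsupport_cutoff_subset s.hd h') i; linarith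
    rw [fderiv_of_notMem_tsupport ℝ hx', zero_apply]

/-- `∫ f = 0` (`div U = 0`). [folklore] -/
theorem integral_datum : ∫ x, datum ρ r U x = 0 := by
  have h := integral_mul_divergence_add_eq_zero_left (cutoff_contDiff (n := 1))
    (s.profile.contDiff_velocity.of_le one_le_two) (hasCompactSupport_cutoff (ρ := ρ) s.hd)
  have hz : ∫ x, cutoff ρ (r - ρ) x * VectorCalculus.divergence U x = 0 := by
    simp [show ∀ x, VectorCalculus.divergence U x = 0 from s.profile.divFree]
  rw [hz, zero_add] at h
  simpa only [datum, inner_gradient_eq_fderiv] using h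

/-- The corrector geometry of the step: `a = ρ + d/8`, `b = ρ + 5d/8`, `δ = d/8`. [folklore] -/
theorem geometry : Geometry (ρ + (r - ρ) / 8) (ρ + 5 * (r - ρ) / 8) ((r - ρ) / 8) (datum ρ r U) where
  ha := by linarith [s.hρpos, s.hd]
  hδ := by linarith [s.hd]
  hring := by linarith [s.hd]
  hb2 := by linarith [s.hdρ, s.hρpos]
  smooth := s.datum_contDiff
  vanish x hx := s.datum_eq_zero hx
  integral_zero := s.integral_datum

/-- The ratio `Q = (b/(b-a))⁵ (b/δ)⁴ ≤ 5⁹ (R/d)⁹`. [folklore] -/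
theorem Q_le : ((ρ + 5 * (r - ρ) / 8) / (ρ + 5 * (r - ρ) / 8 - (ρ + (r - ρ) / 8))) ^ 5 *
      ((ρ + 5 * (r - ρ) / 8) / ((r - ρ) / 8)) ^ 4 ≤ 5 ^ 9 * (R / (r - ρ)) ^ 9 := by
  have hd := s.hd; have hR := s.hR
  have hb : ρ + 5 * (r - ρ) / 8 ≤ 5 * R / 8 := by linarith [s.hρR, s.hd14]
  have hb0 : 0 ≤ ρ + 5 * (r - ρ) / 8 := by linarith [s.hρpos]
  have e1 : (ρ + 5 * (r - ρ) / 8) / (ρ + 5 * (r - ρ) / 8 - (ρ + (r - ρ) / 8)) =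
      2 * (ρ + 5 * (r - ρ) / 8) / (r - ρ) := by
    rw [show ρ + 5 * (r - ρ) / 8 - (ρ + (r - ρ) / 8) = (r - ρ) / 2 by ring]
    field_simp
  have e2 : (ρ + 5 * (r - ρ) / 8) / ((r - ρ) / 8) = 8 * (ρ + 5 * (r - ρ) / 8) / (r - ρ) := by
    field_simp
  rw [e1, e2]
  have h1 : 2 * (ρ + 5 * (r - ρ) / 8) / (r - ρ) ≤ 5 * (R / (r - ρ)) := by
    rw [div_le_iff₀ hd, show 5 * (R / (r - ρ)) * (r - ρ) = 5 * R by field_simp]; linarith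
  have h2 : 8 * (ρ + 5 * (r - ρ) / 8) / (r - ρ) ≤ 5 * (R / (r - ρ)) := by
    rw [div_le_iff₀ hd, show 5 * (R / (r - ρ)) * (r - ρ) = 5 * R by field_simp]; linarith
  have h1' : 0 ≤ 2 * (ρ + 5 * (r - ρ) / 8) / (r - ρ) := by positivity
  have h2' : 0 ≤ 8 * (ρ + 5 * (r - ρ) / 8) / (r - ρ) := by positivity
  calc _ ≤ (5 * (R / (r - ρ))) ^ 5 * (5 * (R / (r - ρ))) ^ 4 :=
        mul_le_mul (pow_le_pow_left₀ h1' h1 5) (pow_le_pow_left₀ h2' h2 4) (by positivity) (by positivity)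
    _ = 5 ^ 9 * (R / (r - ρ)) ^ 9 := by ring

end StepData

end Step

/-! #### The objects of the step -/

section StepObjects

variable {ν R ρ r : ℝ} {U : ℝ³ → ℝ³} {P : ℝ³ → ℝ}

namespace StepData

variable (s : StepData ν R ρ r U P)
include s

omit s in
/-- The cut-off of the step. [folklore] -/
def φ' (ρ r : ℝ) : ℝ³ → ℝ := cutoff ρ (r - ρ)

omit s in
/-- The corrector of the step. [folklore] -/
def w' (ρ r : ℝ) (U : ℝ³ → ℝ³) : ℝ³ → ℝ³ :=
  ringCorrector (ρ + (r - ρ) / 8) (ρ + 5 * (r - ρ) / 8) ((r - ρ) / 8) (datum ρ r U)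

omit s in
/-- The shell `S = S(ρ + d/8, ρ + 5d/8)` carrying `Dφ`, `f` and `w`. [folklore] -/
def S' (ρ r : ℝ) : Set ℝ³ := shell (ρ + (r - ρ) / 8) (ρ + 5 * (r - ρ) / 8)

omit s in
/-- The constant `Φ = 24B/d` bounding `‖Dφ‖`. [folklore] -/
def Φ (ρ r : ℝ) : ℝ := 24 * (B / (r - ρ))

omit s in
/-- The ratio `Q` of the corrector geometry. [folklore] -/
def Q (ρ r : ℝ) : ℝ := ((ρ + 5 * (r - ρ) / 8) / (ρ + 5 * (r - ρ) / 8 - (ρ + (r - ρ) / 8))) ^ 5 *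
      ((ρ + 5 * (r - ρ) / 8) / ((r - ρ) / 8)) ^ 4

/-- Auxiliary (theorem `Φ_pos`): Φ pos. [folklore] -/
theorem Φ_pos : 0 < Φ ρ r := by rw [Φ]; have := B_pos; have := s.hd; positivity

/-- Auxiliary (theorem `Q_nonneg`): Q nonneg. [folklore] -/
theorem Q_nonneg : 0 ≤ Q ρ r := by
  have hd := s.hd; have hρ := s.hρpos
  have h1 : 0 ≤ (ρ + 5 * (r - ρ) / 8) / (ρ + 5 * (r - ρ) / 8 - (ρ + (r - ρ) / 8)) :=
    div_nonneg (by linarith) (by linarith)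
  have h2 : 0 ≤ (ρ + 5 * (r - ρ) / 8) / ((r - ρ) / 8) := div_nonneg (by linarith) (by linarith)
  rw [Q]
  exact mul_nonneg (pow_nonneg h1 5) (pow_nonneg h2 4)

/-- Auxiliary (theorem `Q_le'`): Q le'. [folklore] -/
theorem Q_le' : Q ρ r ≤ 5 ^ 9 * (R / (r - ρ)) ^ 9 := s.Q_le

omit s in
/-- Auxiliary (theorem `shell_mono`): shell mono. [folklore] -/
theorem shell_mono {a a' b b' : ℝ} (ha : a ≤ a') (hb : b' ≤ b) : shell a' b' ⊆ shell a b :=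
  fun _ hx => ⟨hx.1.imp fun _ hi => ha.trans hi, fun i => (hx.2 i).trans hb⟩

omit s in
/-- Auxiliary (theorem `isCompact_S'`): isCompact S'. [folklore] -/
theorem isCompact_S' : IsCompact (S' ρ r) := isCompact_shell _ _

omit s in
/-- Auxiliary (theorem `measurableSet_S'`): measurableSet S'. [folklore] -/
theorem measurableSet_S' : MeasurableSet (S' ρ r) := (isClosed_shell _ _).measurableSet

/-- Auxiliary (theorem `S'_subset_cube`): S' subset cube. [folklore] -/
theorem S'_subset_cube : S' ρ r ⊆ cube r := fun x hx i => (hx.2 i).trans (by linarith [s.hd])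

/-- Auxiliary (theorem `S'_subset_annulus`): S' subset annulus. [folklore] -/
theorem S'_subset_annulus : S' ρ r ⊆ cubeAnnulus R :=
  shell_mono (by linarith [s.hρ, s.hd]) (by linarith [s.hρR, s.hd14, s.hr, s.hρr])

/-- Auxiliary (theorem `inner_subset_S'`): inner subset S'. [folklore] -/
theorem inner_subset_S' :
    shell (ρ + (r - ρ) / 8 + (r - ρ) / 8) (ρ + 5 * (r - ρ) / 8 - (r - ρ) / 8) ⊆ S' ρ r :=
  shell_mono (by linarith [s.hd]) (by linarith [s.hd])

/-- `Dφ = 0` off `S`. [folklore] -/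
theorem fderiv_φ'_eq_zero {x : ℝ³} (hx : x ∉ S' ρ r) : fderiv ℝ (φ' ρ r) x = 0 := by
  have hx' : x ∉ shell (ρ + (r - ρ) / 8 + (r - ρ) / 8) (ρ + 5 * (r - ρ) / 8 - (r - ρ) / 8) :=
    fun h => hx (s.inner_subset_S' h)
  rw [φ']
  rcases not_mem_shell.1 hx' with h | ⟨i, hi⟩
  · exact fderiv_cutoff_eq_zero s.hd (fun i => by have := h i; linarith)
  · have hx'' : x ∉ tsupport (cutoff ρ (r - ρ)) := fun h' => by
      have := (tsupport_cutoff_subset s.hd h') i; linarith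
    exact fderiv_of_notMem_tsupport ℝ hx''

/-- Auxiliary (theorem `datum_eq_zero'`): datum eq zero'. [folklore] -/
theorem datum_eq_zero' {x : ℝ³} (hx : x ∉ S' ρ r) : datum ρ r U x = 0 := by
  rw [datum, show cutoff ρ (r - ρ) = φ' ρ r from rfl, s.fderiv_φ'_eq_zero hx, zero_apply]

/-- Auxiliary (theorem `w'_contDiff`): w' contDiff. [folklore] -/
theorem w'_contDiff : ContDiff ℝ ∞ (w' ρ r U) := s.geometry.contDiff_ringCorrector

/-- Auxiliary (theorem `w'_eq_zero`): w' eq zero. [folklore] -/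
theorem w'_eq_zero {x : ℝ³} (hx : x ∉ S' ρ r) : w' ρ r U x = 0 := s.geometry.ringCorrector_eq_zero hx

/-- Auxiliary (theorem `tsupport_w'_subset`): tsupport w' subset. [folklore] -/
theorem tsupport_w'_subset : tsupport (w' ρ r U) ⊆ S' ρ r := s.geometry.tsupport_ringCorrector_subset

/-- Auxiliary (theorem `hasCompactSupport_w'`): hasCompactSupport w'. [folklore] -/
theorem hasCompactSupport_w' : HasCompactSupport (w' ρ r U) := s.geometry.hasCompactSupport_ringCorrector

/-- Auxiliary (theorem `fderiv_w'_eq_zero`): fderiv w' eq zero. [folklore] -/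
theorem fderiv_w'_eq_zero {x : ℝ³} (hx : x ∉ S' ρ r) : fderiv ℝ (w' ρ r U) x = 0 :=
  fderiv_of_notMem_tsupport ℝ fun h => hx (s.tsupport_w'_subset h)

/-- Auxiliary (theorem `divergence_w'`): divergence w'. [folklore] -/
theorem divergence_w' (x : ℝ³) : VectorCalculus.divergence (w' ρ r U) x = fderiv ℝ (φ' ρ r) x (U x) :=
  s.geometry.divergence_ringCorrector x

/-- Auxiliary (theorem `norm_fderiv_φ'_le`): norm fderiv φ' le. [folklore] -/
theorem norm_fderiv_φ'_le (x : ℝ³) : ‖fderiv ℝ (φ' ρ r) x‖ ≤ Φ ρ r := norm_fderiv_cutoff_le s.hd x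

/-- Auxiliary (theorem `abs_fderiv_φ'_apply_e_le`): abs fderiv φ' apply e le. [folklore] -/
theorem abs_fderiv_φ'_apply_e_le (x : ℝ³) (i : Fin 3) : |fderiv ℝ (φ' ρ r) x (e i)| ≤ Φ ρ r := by
  rw [← Real.norm_eq_abs]
  refine (ContinuousLinearMap.le_opNorm _ _).trans ?_
  rw [norm_e, mul_one]; exact s.norm_fderiv_φ'_le x

/-- Auxiliary (theorem `abs_datum_le'`): abs datum le'. [folklore] -/
theorem abs_datum_le' (x : ℝ³) : |datum ρ r U x| ≤ Φ ρ r * ‖U x‖ := s.abs_datum_le x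

/-! #### Continuity and integrability bookkeeping -/

/-- Auxiliary (theorem `hUc`): hUc. [folklore] -/
theorem hUc : Continuous U := s.smooth.continuous
/-- Auxiliary (theorem `hDUi`): hDUi. [folklore] -/
theorem hDUi (i : Fin 3) : Continuous fun x => fderiv ℝ U x (e i) :=
  (s.smooth.continuous_fderiv (by simp)).clm_apply continuous_const
/-- Auxiliary (theorem `hgradc`): hgradc. [folklore] -/
theorem hgradc : Continuous (gradSq U) := continuous_gradSq (s.smooth.of_le (by simp))
omit s in
/-- Auxiliary (theorem `hφc`): hφc. [folklore] -/
theorem hφc : Continuous (φ' ρ r) := (cutoff_contDiff (n := 0)).continuous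

omit s in
/-- Auxiliary (theorem `hDφc`): hDφc. [folklore] -/
theorem hDφc : Continuous (fderiv ℝ (φ' ρ r)) := (cutoff_contDiff (n := 1)).continuous_fderiv (by simp)
/-- Auxiliary (theorem `hfc`): hfc. [folklore] -/
theorem hfc : Continuous (datum ρ r U) := s.datum_contDiff.continuous
/-- Auxiliary (theorem `hwc`): hwc. [folklore] -/
theorem hwc : Continuous (w' ρ r U) := s.w'_contDiff.continuous
/-- Auxiliary (theorem `hDwc`): hDwc. [folklore] -/
theorem hDwc : Continuous (fderiv ℝ (w' ρ r U)) := s.w'_contDiff.continuous_fderiv (by simp)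

omit s in
/-- Auxiliary (theorem `integrableOn_of_continuous`): integrableOn of continuous. [folklore] -/
theorem integrableOn_of_continuous {X : Type*} [NormedAddCommGroup X] {g : ℝ³ → X}
    (hg : Continuous g) {K : Set ℝ³} (hK : IsCompact K) : IntegrableOn g K volume :=
  hg.continuousOn.integrableOn_compact hK

/-! #### `L^n` norms of the datum and of `Dw` -/

/-- `∫ |f|ⁿ ≤ Φⁿ ∫_S |U|ⁿ`. [folklore] -/
theorem integral_abs_datum_pow_le {n : ℕ} (hn : n ≠ 0) :
    ∫ x, |datum ρ r U x| ^ n ≤ Φ ρ r ^ n * ∫ x in S' ρ r, ‖U x‖ ^ n := by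
  have hΦ := s.Φ_pos.le
  rw [← setIntegral_eq_integral_of_forall_compl_eq_zero (s := S' ρ r)
    (fun x hx => by rw [s.datum_eq_zero' hx, abs_zero, zero_pow hn]),
    ← MeasureTheory.integral_const_mul]
  refine setIntegral_mono_on (integrableOn_of_continuous (s.hfc.abs.pow n) isCompact_S')
    (integrableOn_of_continuous (continuous_const.mul (s.hUc.norm.pow n)) isCompact_S')
    measurableSet_S' fun x _ => ?_
  rw [← mul_pow]
  exact pow_le_pow_left₀ (abs_nonneg _) (s.abs_datum_le' x) n

/-- `∫ ‖Dw‖² ≤ (K₂QΦ)² ∫_S |U|²` and `∫ ‖Dw‖³ ≤ (K₃QΦ)³ ∫_S |U|³`. [folklore] -/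
theorem integral_pow_fderiv_w'_le :
    (∫ x, ‖fderiv ℝ (w' ρ r U) x‖ ^ 2 ≤ (K2 * Q ρ r * Φ ρ r) ^ 2 * ∫ x in S' ρ r, ‖U x‖ ^ 2) ∧
    (∫ x, ‖fderiv ℝ (w' ρ r U) x‖ ^ 3 ≤ (K3 * Q ρ r * Φ ρ r) ^ 3 * ∫ x in S' ρ r, ‖U x‖ ^ 3) := by
  obtain ⟨h2, h3⟩ := integral_pow_fderiv_ringCorrector_le s.geometry
  have e2 : K2 * ((ρ + 5 * (r - ρ) / 8) / (ρ + 5 * (r - ρ) / 8 - (ρ + (r - ρ) / 8))) ^ 5 *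
      ((ρ + 5 * (r - ρ) / 8) / ((r - ρ) / 8)) ^ 4 = K2 * Q ρ r := by rw [Q]; ring
  have e3 : K3 * ((ρ + 5 * (r - ρ) / 8) / (ρ + 5 * (r - ρ) / 8 - (ρ + (r - ρ) / 8))) ^ 5 *
      ((ρ + 5 * (r - ρ) / 8) / ((r - ρ) / 8)) ^ 4 = K3 * Q ρ r := by rw [Q]; ring
  rw [e2] at h2; rw [e3] at h3
  have hq := s.Q_nonneg
  have d2 := s.integral_abs_datum_pow_le (n := 2) (by norm_num)
  have d3 := s.integral_abs_datum_pow_le (n := 3) (by norm_num)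
  refine ⟨h2.trans ?_, h3.trans ?_⟩
  · rw [show (K2 * Q ρ r * Φ ρ r) ^ 2 * ∫ x in S' ρ r, ‖U x‖ ^ 2 =
      (K2 * Q ρ r) ^ 2 * (Φ ρ r ^ 2 * ∫ x in S' ρ r, ‖U x‖ ^ 2) by ring]
    exact mul_le_mul_of_nonneg_left d2 (by have := K2_pos; positivity)
  · rw [show (K3 * Q ρ r * Φ ρ r) ^ 3 * ∫ x in S' ρ r, ‖U x‖ ^ 3 =
      (K3 * Q ρ r) ^ 3 * (Φ ρ r ^ 3 * ∫ x in S' ρ r, ‖U x‖ ^ 3) by ring]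
    exact mul_le_mul_of_nonneg_left d3 (by have := K3_pos; positivity)

end StepData

end StepObjects

/-! #### The four terms -/

section Terms

variable {ν R ρ r : ℝ} {U : ℝ³ → ℝ³} {P : ℝ³ → ℝ}

namespace StepData

variable (s : StepData ν R ρ r U P)
include s

/-- Auxiliary (theorem `Q_pos`): Q pos. [folklore] -/
theorem Q_pos : 0 < Q ρ r := by
  have hd := s.hd; have hρ := s.hρpos
  have h1 : 0 < (ρ + 5 * (r - ρ) / 8) / (ρ + 5 * (r - ρ) / 8 - (ρ + (r - ρ) / 8)) :=
    div_pos (by linarith) (by linarith)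
  have h2 : 0 < (ρ + 5 * (r - ρ) / 8) / ((r - ρ) / 8) := div_pos (by linarith) (by linarith)
  rw [Q]; positivity

/-- `∫_S |∇U|² ≤ ∫_{cube r} |∇U|²`. [folklore] -/
theorem setIntegral_gradSq_S'_le :
    ∫ x in S' ρ r, gradSq U x ≤ ∫ x in cube r, gradSq U x :=
  setIntegral_mono_set (integrableOn_of_continuous s.hgradc (isCompact_cube r))
    (Eventually.of_forall fun x => gradSq_nonneg U x) s.S'_subset_cube.eventuallyLE

/-- `∫_S |U|ⁿ ≤ ∫_A |U|ⁿ`. [folklore] -/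
theorem setIntegral_pow_S'_le (n : ℕ) :
    ∫ x in S' ρ r, ‖U x‖ ^ n ≤ ∫ x in cubeAnnulus R, ‖U x‖ ^ n :=
  setIntegral_mono_set (integrableOn_of_continuous (s.hUc.norm.pow n) (isCompact_cubeAnnulus R))
    (Eventually.of_forall fun x => by positivity) s.S'_subset_annulus.eventuallyLE

omit s in
/-- A whole-space integral of a function vanishing off `S` is bounded by the set integral of a
pointwise bound on `S`. [folklore] -/
theorem abs_integral_le_of_vanish {g h : ℝ³ → ℝ} (hg : Continuous g) (hh : Continuous h)
    (hg0 : ∀ x, x ∉ S' ρ r → g x = 0) (hle : ∀ x ∈ S' ρ r, |g x| ≤ h x) :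
    |∫ x, g x| ≤ ∫ x in S' ρ r, h x := by
  rw [← setIntegral_eq_integral_of_forall_compl_eq_zero hg0]
  refine (MeasureTheory.abs_integral_le_integral_abs).trans ?_
  exact setIntegral_mono_on (integrableOn_of_continuous hg.abs isCompact_S')
    (integrableOn_of_continuous hh isCompact_S') measurableSet_S' hle

/-- **Term 1**: `|Σᵢ ∫ ∂ᵢφ ⟪∂ᵢU, U⟫| ≤ ¼ ∫_{cube r}|∇U|² + 3Φ² ∫_S |U|²`. [folklore] -/
theorem term1_le :
    |∑ i, ∫ x, fderiv ℝ (φ' ρ r) x (e i) * ⟪fderiv ℝ U x (e i), U x⟫| ≤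
      (∫ x in cube r, gradSq U x) / 4 + 3 * Φ ρ r ^ 2 * ∫ x in S' ρ r, ‖U x‖ ^ 2 := by
  have hΦ := s.Φ_pos.le
  have hi : ∀ i, |∫ x, fderiv ℝ (φ' ρ r) x (e i) * ⟪fderiv ℝ U x (e i), U x⟫| ≤
      ∫ x in S' ρ r, (‖fderiv ℝ U x (e i)‖ ^ 2 / 4 + Φ ρ r ^ 2 * ‖U x‖ ^ 2) := by
    intro i
    refine abs_integral_le_of_vanish ((hDφc.clm_apply continuous_const).mul
      ((s.hDUi i).inner s.hUc)) (((s.hDUi i).norm.pow 2).div_const _ |>.add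
      (continuous_const.mul (s.hUc.norm.pow 2))) (fun x hx => by
        rw [s.fderiv_φ'_eq_zero hx, zero_apply, zero_mul]) fun x _ => ?_
    rw [abs_mul]
    calc |fderiv ℝ (φ' ρ r) x (e i)| * |⟪fderiv ℝ U x (e i), U x⟫|
        ≤ Φ ρ r * (‖fderiv ℝ U x (e i)‖ * ‖U x‖) :=
          mul_le_mul (s.abs_fderiv_φ'_apply_e_le x i) (abs_real_inner_le_norm _ _) (abs_nonneg _) hΦ
      _ = ‖fderiv ℝ U x (e i)‖ * (Φ ρ r * ‖U x‖) := by ring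
      _ ≤ ‖fderiv ℝ U x (e i)‖ ^ 2 / 4 + (Φ ρ r * ‖U x‖) ^ 2 := young_two _ _
      _ = _ := by ring
  have iI : ∀ i, IntegrableOn (fun x => ‖fderiv ℝ U x (e i)‖ ^ 2) (S' ρ r) volume := fun i =>
    integrableOn_of_continuous ((s.hDUi i).norm.pow 2) isCompact_S'
  have iI4 : ∀ i, IntegrableOn (fun x => ‖fderiv ℝ U x (e i)‖ ^ 2 / 4) (S' ρ r) volume := fun i =>
    integrableOn_of_continuous (((s.hDUi i).norm.pow 2).div_const _) isCompact_S'
  have iU : IntegrableOn (fun x => Φ ρ r ^ 2 * ‖U x‖ ^ 2) (S' ρ r) volume :=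
    integrableOn_of_continuous (continuous_const.mul (s.hUc.norm.pow 2)) isCompact_S'
  have hsplit : ∀ i, ∫ x in S' ρ r, (‖fderiv ℝ U x (e i)‖ ^ 2 / 4 + Φ ρ r ^ 2 * ‖U x‖ ^ 2) =
      (∫ x in S' ρ r, ‖fderiv ℝ U x (e i)‖ ^ 2) / 4 + Φ ρ r ^ 2 * ∫ x in S' ρ r, ‖U x‖ ^ 2 := by
    intro i
    rw [integral_add (iI4 i) iU, MeasureTheory.integral_div, MeasureTheory.integral_const_mul]
  have hsum : ∑ i, ∫ x in S' ρ r, ‖fderiv ℝ U x (e i)‖ ^ 2 = ∫ x in S' ρ r, gradSq U x := by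
    rw [← integral_finsetSum _ (fun i _ => iI i)]
    rfl
  calc _ ≤ ∑ i, |∫ x, fderiv ℝ (φ' ρ r) x (e i) * ⟪fderiv ℝ U x (e i), U x⟫| := Finset.abs_sum_le_sum_abs _ _
    _ ≤ ∑ i, ((∫ x in S' ρ r, ‖fderiv ℝ U x (e i)‖ ^ 2) / 4 + Φ ρ r ^ 2 * ∫ x in S' ρ r, ‖U x‖ ^ 2) :=
        Finset.sum_le_sum fun i _ => (hi i).trans_eq (hsplit i)
    _ = (∫ x in S' ρ r, gradSq U x) / 4 + 3 * Φ ρ r ^ 2 * ∫ x in S' ρ r, ‖U x‖ ^ 2 := by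
        rw [Finset.sum_add_distrib, ← Finset.sum_div, hsum]
        simp only [Finset.sum_const, Finset.card_univ, Fintype.card_fin, nsmul_eq_mul]
        push_cast; ring
    _ ≤ _ := by linarith [s.setIntegral_gradSq_S'_le]

/-- **Term 2**: `|Σᵢ ∫ ⟪∂ᵢU, ∂ᵢw⟫| ≤ ¼ ∫_{cube r}|∇U|² + 3 (K₂QΦ)² ∫_S |U|²`. [folklore] -/
theorem term2_le :
    |∑ i, ∫ x, ⟪fderiv ℝ U x (e i), fderiv ℝ (w' ρ r U) x (e i)⟫| ≤
      (∫ x in cube r, gradSq U x) / 4 + 3 * (K2 * Q ρ r * Φ ρ r) ^ 2 * ∫ x in S' ρ r, ‖U x‖ ^ 2 := by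
  set w := w' ρ r U with hw
  have hDw : ∀ i, Continuous fun x => fderiv ℝ w x (e i) := fun i => s.hDwc.clm_apply continuous_const
  have hi : ∀ i, |∫ x, ⟪fderiv ℝ U x (e i), fderiv ℝ w x (e i)⟫| ≤
      ∫ x in S' ρ r, (‖fderiv ℝ U x (e i)‖ ^ 2 / 4 + ‖fderiv ℝ w x‖ ^ 2) := by
    intro i
    refine abs_integral_le_of_vanish ((s.hDUi i).inner (hDw i))
      ((((s.hDUi i).norm.pow 2).div_const _).add (s.hDwc.norm.pow 2)) (fun x hx => by
        rw [s.fderiv_w'_eq_zero hx, zero_apply, inner_zero_right]) fun x _ => ?_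
    calc |⟪fderiv ℝ U x (e i), fderiv ℝ w x (e i)⟫| ≤ ‖fderiv ℝ U x (e i)‖ * ‖fderiv ℝ w x (e i)‖ :=
          abs_real_inner_le_norm _ _
      _ ≤ ‖fderiv ℝ U x (e i)‖ * ‖fderiv ℝ w x‖ := by
          refine mul_le_mul_of_nonneg_left ?_ (norm_nonneg _)
          refine (ContinuousLinearMap.le_opNorm _ _).trans ?_; rw [norm_e, mul_one]
      _ ≤ _ := young_two _ _
  have iI : ∀ i, IntegrableOn (fun x => ‖fderiv ℝ U x (e i)‖ ^ 2) (S' ρ r) volume := fun i =>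
    integrableOn_of_continuous ((s.hDUi i).norm.pow 2) isCompact_S'
  have iI4 : ∀ i, IntegrableOn (fun x => ‖fderiv ℝ U x (e i)‖ ^ 2 / 4) (S' ρ r) volume := fun i =>
    integrableOn_of_continuous (((s.hDUi i).norm.pow 2).div_const _) isCompact_S'
  have iW : IntegrableOn (fun x => ‖fderiv ℝ w x‖ ^ 2) (S' ρ r) volume :=
    integrableOn_of_continuous (s.hDwc.norm.pow 2) isCompact_S'
  have hsplit : ∀ i, ∫ x in S' ρ r, (‖fderiv ℝ U x (e i)‖ ^ 2 / 4 + ‖fderiv ℝ w x‖ ^ 2) =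
      (∫ x in S' ρ r, ‖fderiv ℝ U x (e i)‖ ^ 2) / 4 + ∫ x in S' ρ r, ‖fderiv ℝ w x‖ ^ 2 := by
    intro i
    rw [integral_add (iI4 i) iW, MeasureTheory.integral_div]
  have hsum : ∑ i, ∫ x in S' ρ r, ‖fderiv ℝ U x (e i)‖ ^ 2 = ∫ x in S' ρ r, gradSq U x := by
    rw [← integral_finsetSum _ (fun i _ => iI i)]
    rfl
  have hDw2 : ∫ x in S' ρ r, ‖fderiv ℝ w x‖ ^ 2 ≤ (K2 * Q ρ r * Φ ρ r) ^ 2 * ∫ x in S' ρ r, ‖U x‖ ^ 2 := by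
    rw [setIntegral_eq_integral_of_forall_compl_eq_zero (fun x hx => by
      rw [s.fderiv_w'_eq_zero hx, norm_zero]; norm_num)]
    exact s.integral_pow_fderiv_w'_le.1
  calc _ ≤ ∑ i, |∫ x, ⟪fderiv ℝ U x (e i), fderiv ℝ w x (e i)⟫| := Finset.abs_sum_le_sum_abs _ _
    _ ≤ ∑ i, ((∫ x in S' ρ r, ‖fderiv ℝ U x (e i)‖ ^ 2) / 4 + ∫ x in S' ρ r, ‖fderiv ℝ w x‖ ^ 2) :=
        Finset.sum_le_sum fun i _ => (hi i).trans_eq (hsplit i)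
    _ = (∫ x in S' ρ r, gradSq U x) / 4 + 3 * ∫ x in S' ρ r, ‖fderiv ℝ w x‖ ^ 2 := by
        rw [Finset.sum_add_distrib, ← Finset.sum_div, hsum]
        simp only [Finset.sum_const, Finset.card_univ, Fintype.card_fin, nsmul_eq_mul]
        push_cast; ring
    _ ≤ _ := by nlinarith [s.setIntegral_gradSq_S'_le, hDw2]

/-- **Term 3**: `|∫ Dφ[U] |U|²| ≤ Φ ∫_S |U|³`. [folklore] -/
theorem term3_le :
    |∫ x, datum ρ r U x * ‖U x‖ ^ 2| ≤ Φ ρ r * ∫ x in S' ρ r, ‖U x‖ ^ 3 := by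
  rw [← MeasureTheory.integral_const_mul]
  refine abs_integral_le_of_vanish (s.hfc.mul (s.hUc.norm.pow 2))
    (continuous_const.mul (s.hUc.norm.pow 3)) (fun x hx => by rw [s.datum_eq_zero' hx, zero_mul])
    fun x _ => ?_
  rw [abs_mul, abs_pow, abs_norm]
  calc |datum ρ r U x| * ‖U x‖ ^ 2 ≤ (Φ ρ r * ‖U x‖) * ‖U x‖ ^ 2 :=
        mul_le_mul_of_nonneg_right (s.abs_datum_le' x) (by positivity)
    _ = Φ ρ r * ‖U x‖ ^ 3 := by ring

/-- **Term 4**: `|∫ ⟪U, Dw[U]⟫| ≤ K₃QΦ ∫_S |U|³` (weighted AM–GM with `L = K₃QΦ`). [folklore] -/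
theorem term4_le :
    |∫ x, ⟪U x, fderiv ℝ (w' ρ r U) x (U x)⟫| ≤ (K3 * Q ρ r * Φ ρ r) * ∫ x in S' ρ r, ‖U x‖ ^ 3 := by
  set w := w' ρ r U with hw
  set L := K3 * Q ρ r * Φ ρ r with hL
  have hLpos : 0 < L := by rw [hL]; exact mul_pos (mul_pos K3_pos s.Q_pos) s.Φ_pos
  have h1 : |∫ x, ⟪U x, fderiv ℝ w x (U x)⟫| ≤
      ∫ x in S' ρ r, (2 * L / 3 * ‖U x‖ ^ 3 + ‖fderiv ℝ w x‖ ^ 3 / (3 * L ^ 2)) := by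
    refine abs_integral_le_of_vanish (s.hUc.inner (s.hDwc.clm_apply s.hUc))
      ((continuous_const.mul (s.hUc.norm.pow 3)).add ((s.hDwc.norm.pow 3).div_const _))
      (fun x hx => by rw [s.fderiv_w'_eq_zero hx, zero_apply, inner_zero_right]) fun x _ => ?_
    calc |⟪U x, fderiv ℝ w x (U x)⟫| ≤ ‖U x‖ * ‖fderiv ℝ w x (U x)‖ := abs_real_inner_le_norm _ _
      _ ≤ ‖U x‖ * (‖fderiv ℝ w x‖ * ‖U x‖) :=
          mul_le_mul_of_nonneg_left (ContinuousLinearMap.le_opNorm _ _) (norm_nonneg _)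
      _ = ‖U x‖ ^ 2 * ‖fderiv ℝ w x‖ := by ring
      _ ≤ _ := young_three (norm_nonneg _) (norm_nonneg _) hLpos
  have iU3 : IntegrableOn (fun x => 2 * L / 3 * ‖U x‖ ^ 3) (S' ρ r) volume :=
    integrableOn_of_continuous (continuous_const.mul (s.hUc.norm.pow 3)) isCompact_S'
  have iW3 : IntegrableOn (fun x => ‖fderiv ℝ w x‖ ^ 3 / (3 * L ^ 2)) (S' ρ r) volume :=
    integrableOn_of_continuous ((s.hDwc.norm.pow 3).div_const _) isCompact_S'
  have h2 : ∫ x in S' ρ r, (2 * L / 3 * ‖U x‖ ^ 3 + ‖fderiv ℝ w x‖ ^ 3 / (3 * L ^ 2)) =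
      2 * L / 3 * (∫ x in S' ρ r, ‖U x‖ ^ 3) + (∫ x in S' ρ r, ‖fderiv ℝ w x‖ ^ 3) / (3 * L ^ 2) := by
    rw [integral_add iU3 iW3, MeasureTheory.integral_const_mul, MeasureTheory.integral_div]
  have h3 : ∫ x in S' ρ r, ‖fderiv ℝ w x‖ ^ 3 ≤ L ^ 3 * ∫ x in S' ρ r, ‖U x‖ ^ 3 := by
    rw [setIntegral_eq_integral_of_forall_compl_eq_zero (fun x hx => by
      rw [s.fderiv_w'_eq_zero hx, norm_zero]; norm_num)]
    exact s.integral_pow_fderiv_w'_le.2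
  have hN : 0 ≤ ∫ x in S' ρ r, ‖U x‖ ^ 3 := integral_nonneg fun x => by positivity
  calc _ ≤ _ := h1
    _ = _ := h2
    _ ≤ 2 * L / 3 * (∫ x in S' ρ r, ‖U x‖ ^ 3) + (L ^ 3 * ∫ x in S' ρ r, ‖U x‖ ^ 3) / (3 * L ^ 2) := by
        gcongr
    _ = L * ∫ x in S' ρ r, ‖U x‖ ^ 3 := by field_simp; ring

end StepData

end Terms

/-! #### The step inequality and the Caccioppoli inequality -/

section Assembly

variable {ν R ρ r : ℝ} {U : ℝ³ → ℝ³} {P : ℝ³ → ℝ}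

/-- `F(t) = ν ∫_{cube t} |∇U|²`. [folklore] -/
def F (ν : ℝ) (U : ℝ³ → ℝ³) (t : ℝ) : ℝ := ν * ∫ x in cube t, gradSq U x

/-- Auxiliary (theorem `cube_mono`): cube mono. [folklore] -/
theorem cube_mono {t t' : ℝ} (h : t ≤ t') : cube t ⊆ cube t' := fun _ hx i => (hx i).trans h

/-- The absolute constants of the step. [folklore] -/
def C₂ : ℝ := 1728 * B ^ 2 * (1 + K2 ^ 2 * 5 ^ 18)

/-- See `C₂`. [folklore] -/
def C₃ : ℝ := 24 * B * (1 / 2 + K3 * 5 ^ 9)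

/-- Auxiliary (theorem `C₂_pos`): C₂ pos. [folklore] -/
theorem C₂_pos : 0 < C₂ := by rw [C₂]; have := B_pos; positivity
/-- Auxiliary (theorem `C₃_pos`): C₃ pos. [folklore] -/
theorem C₃_pos : 0 < C₃ := by rw [C₃]; have := B_pos; have := K3_pos; positivity

namespace StepData

variable (s : StepData ν R ρ r U P)
include s

/-- Auxiliary (theorem `F_nonneg`): F nonneg. [folklore] -/
theorem F_nonneg (t : ℝ) : 0 ≤ F ν U t :=
  mul_nonneg s.hν.le (integral_nonneg fun x => gradSq_nonneg U x)

/-- Auxiliary (theorem `F_mono`): F mono. [folklore] -/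
theorem F_mono {t t' : ℝ} (h : t ≤ t') : F ν U t ≤ F ν U t' :=
  mul_le_mul_of_nonneg_left (setIntegral_mono_set (integrableOn_of_continuous s.hgradc (isCompact_cube t'))
    (Eventually.of_forall fun x => gradSq_nonneg U x) (cube_mono h).eventuallyLE) s.hν.le

/-- `F(ρ) ≤ ν ∫ φ |∇U|²`. [folklore] -/
theorem F_le_integral_cutoff : F ν U ρ ≤ ν * ∫ x, φ' ρ r x * gradSq U x := by
  refine mul_le_mul_of_nonneg_left ?_ s.hν.le
  have h1 : ∫ x in cube ρ, gradSq U x = ∫ x in cube ρ, φ' ρ r x * gradSq U x :=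
    setIntegral_congr_fun (isClosed_cube ρ).measurableSet fun x hx => by
      rw [φ', cutoff_eq_one s.hd (fun i => (hx i).trans (by linarith [s.hd])), one_mul]
  rw [h1]
  exact setIntegral_le_integral ((hφc.mul s.hgradc).integrable_of_hasCompactSupport
    (hasCompactSupport_cutoff (ρ := ρ) s.hd).mul_right)
    (Eventually.of_forall fun x => mul_nonneg (cutoff_nonneg s.hd x) (gradSq_nonneg U x))

/-- **The step inequality**: `F(ρ) ≤ ½F(r) + 3νΦ²(1 + (K₂Q)²) ‖U‖²_{L²(A)} + Φ(½ + K₃Q) ‖U‖³_{L³(A)}`.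
[folklore] -/
theorem step_ineq : F ν U ρ ≤ F ν U r / 2 +
    (3 * ν * Φ ρ r ^ 2 * (1 + (K2 * Q ρ r) ^ 2) * (∫ x in cubeAnnulus R, ‖U x‖ ^ 2) +
      Φ ρ r * (1 / 2 + K3 * Q ρ r) * ∫ x in cubeAnnulus R, ‖U x‖ ^ 3) := by
  have hν := s.hν
  have hΦ := s.Φ_pos
  have hQ := s.Q_pos
  have EI := energy_identity s.profile (φ := φ' ρ r) (w := w' ρ r U) cutoff_contDiff
    (hasCompactSupport_cutoff (ρ := ρ) s.hd) (s.w'_contDiff.of_le (by simp)) s.hasCompactSupport_w'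
    (fun x => s.divergence_w' x)
  have T1 := s.term1_le; have T2 := s.term2_le; have T3 := s.term3_le; have T4 := s.term4_le
  have N2 := s.setIntegral_pow_S'_le 2; have N3 := s.setIntegral_pow_S'_le 3
  have hN2S : 0 ≤ ∫ x in S' ρ r, ‖U x‖ ^ 2 := integral_nonneg fun x => by positivity
  have hN3S : 0 ≤ ∫ x in S' ρ r, ‖U x‖ ^ 3 := integral_nonneg fun x => by positivity
  have hL := s.F_le_integral_cutoff
  -- abbreviations
  set A1 := ∑ i, ∫ x, fderiv ℝ (φ' ρ r) x (e i) * ⟪fderiv ℝ U x (e i), U x⟫ with hA1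
  set A2 := ∑ i, ∫ x, ⟪fderiv ℝ U x (e i), fderiv ℝ (w' ρ r U) x (e i)⟫ with hA2
  set A3 := ∫ x, datum ρ r U x * ‖U x‖ ^ 2 with hA3
  set A4 := ∫ x, ⟪U x, fderiv ℝ (w' ρ r U) x (U x)⟫ with hA4
  set Gr := ∫ x in cube r, gradSq U x with hGr
  have hEI : ν * ∫ x, φ' ρ r x * gradSq U x = -(ν * A1) + ν * A2 + 1 / 2 * A3 - A4 := EI
  have hFr : F ν U r = ν * Gr := rfl
  -- absolute values
  have b1 : -(ν * A1) ≤ ν * |A1| := by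
    have := neg_abs_le A1; nlinarith
  have b2 : ν * A2 ≤ ν * |A2| := mul_le_mul_of_nonneg_left (le_abs_self _) hν.le
  have b3 : 1 / 2 * A3 ≤ 1 / 2 * |A3| := by linarith [le_abs_self A3]
  have b4 : -A4 ≤ |A4| := neg_le_abs A4
  -- coefficients are nonnegative
  have c1 : 0 ≤ 3 * ν * Φ ρ r ^ 2 := by positivity
  have c2 : 0 ≤ 3 * ν * (K2 * Q ρ r * Φ ρ r) ^ 2 := by positivity
  have c3 : 0 ≤ Φ ρ r / 2 := by positivity
  have c4 : 0 ≤ K3 * Q ρ r * Φ ρ r := by have := K3_pos; positivity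
  -- chain
  have T1' := mul_le_mul_of_nonneg_left T1 hν.le
  have T2' := mul_le_mul_of_nonneg_left T2 hν.le
  have M1 := mul_le_mul_of_nonneg_left N2 c1
  have M2 := mul_le_mul_of_nonneg_left N2 c2
  have M3 := mul_le_mul_of_nonneg_left N3 c3
  have M4 := mul_le_mul_of_nonneg_left N3 c4
  have key : F ν U ρ ≤ ν * (Gr / 4) + 3 * ν * Φ ρ r ^ 2 * (∫ x in cubeAnnulus R, ‖U x‖ ^ 2) +
      (ν * (Gr / 4) + 3 * ν * (K2 * Q ρ r * Φ ρ r) ^ 2 * ∫ x in cubeAnnulus R, ‖U x‖ ^ 2) +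
      Φ ρ r / 2 * (∫ x in cubeAnnulus R, ‖U x‖ ^ 3) +
      K3 * Q ρ r * Φ ρ r * ∫ x in cubeAnnulus R, ‖U x‖ ^ 3 := by
    linarith
  rw [hFr]
  refine key.trans (le_of_eq ?_)
  ring

/-- The coefficient bounds: `3νΦ²(1 + (K₂Q)²) ≤ ν C₂ R¹⁸/d²⁰`, `Φ(½ + K₃Q) ≤ C₃ R¹⁹/d²⁰`.
[folklore] -/
theorem coeff_le :
    3 * ν * Φ ρ r ^ 2 * (1 + (K2 * Q ρ r) ^ 2) ≤ ν * C₂ * R ^ 18 / (r - ρ) ^ 20 ∧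
    Φ ρ r * (1 / 2 + K3 * Q ρ r) ≤ C₃ * R ^ 19 / (r - ρ) ^ 20 := by
  have hd := s.hd; have hR := s.hR; have hν := s.hν
  set t := R / (r - ρ) with ht
  have ht1 : 1 ≤ t := by rw [ht, le_div_iff₀ hd, one_mul]; exact s.hdR
  have hQt : Q ρ r ≤ 5 ^ 9 * t ^ 9 := s.Q_le'
  have hQ0 := s.Q_pos.le
  have hB := B_pos
  have hΦ : Φ ρ r = 24 * B / (r - ρ) := by rw [Φ]; ring
  have t18 : 1 ≤ t ^ 18 := one_le_pow₀ ht1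
  have t19 : 1 ≤ t ^ 19 := one_le_pow₀ ht1
  have t9_19 : t ^ 9 ≤ t ^ 19 := pow_le_pow_right₀ ht1 (by norm_num)
  refine ⟨?_, ?_⟩
  · -- `(K₂Q)² ≤ K₂² 5¹⁸ t¹⁸`
    have h1 : (K2 * Q ρ r) ^ 2 ≤ K2 ^ 2 * 5 ^ 18 * t ^ 18 := by
      have : K2 * Q ρ r ≤ K2 * (5 ^ 9 * t ^ 9) := mul_le_mul_of_nonneg_left hQt K2_pos.le
      have h0 : 0 ≤ K2 * Q ρ r := mul_nonneg K2_pos.le hQ0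
      calc (K2 * Q ρ r) ^ 2 ≤ (K2 * (5 ^ 9 * t ^ 9)) ^ 2 := pow_le_pow_left₀ h0 this 2
        _ = K2 ^ 2 * 5 ^ 18 * t ^ 18 := by ring
    have h2 : 1 + (K2 * Q ρ r) ^ 2 ≤ (1 + K2 ^ 2 * 5 ^ 18) * t ^ 18 := by nlinarith [K2_pos]
    have e : ν * C₂ * R ^ 18 / (r - ρ) ^ 20 = 3 * ν * (24 * B / (r - ρ)) ^ 2 * ((1 + K2 ^ 2 * 5 ^ 18) * t ^ 18) := by
      rw [C₂, ht]; field_simp; ring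
    rw [e, hΦ]
    exact mul_le_mul_of_nonneg_left h2 (by positivity)
  · have h2 : 1 / 2 + K3 * Q ρ r ≤ (1 / 2 + K3 * 5 ^ 9) * t ^ 19 := by
      have : K3 * Q ρ r ≤ K3 * (5 ^ 9 * t ^ 9) := mul_le_mul_of_nonneg_left hQt K3_pos.le
      nlinarith [K3_pos]
    have e : C₃ * R ^ 19 / (r - ρ) ^ 20 = (24 * B / (r - ρ)) * ((1 / 2 + K3 * 5 ^ 9) * t ^ 19) := by
      rw [C₃, ht]; field_simp
    rw [e, hΦ]
    exact mul_le_mul_of_nonneg_left h2 (by positivity)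

/-- The recursion in the form of the absorption lemma. [folklore] -/
theorem recursion :
    F ν U ρ ≤ 1 / 2 * F ν U r +
      (ν * C₂ * R ^ 18 * (∫ x in cubeAnnulus R, ‖U x‖ ^ 2) + C₃ * R ^ 19 * ∫ x in cubeAnnulus R, ‖U x‖ ^ 3)
        / (r - ρ) ^ 20 := by
  have h := s.step_ineq
  obtain ⟨c2, c3⟩ := s.coeff_le
  have hN2 : 0 ≤ ∫ x in cubeAnnulus R, ‖U x‖ ^ 2 := integral_nonneg fun x => by positivity
  have hN3 : 0 ≤ ∫ x in cubeAnnulus R, ‖U x‖ ^ 3 := integral_nonneg fun x => by positivity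
  have hd20 : 0 < (r - ρ) ^ 20 := pow_pos s.hd 20
  rw [add_div, show ν * C₂ * R ^ 18 * (∫ x in cubeAnnulus R, ‖U x‖ ^ 2) / (r - ρ) ^ 20 =
    ν * C₂ * R ^ 18 / (r - ρ) ^ 20 * ∫ x in cubeAnnulus R, ‖U x‖ ^ 2 by ring,
    show C₃ * R ^ 19 * (∫ x in cubeAnnulus R, ‖U x‖ ^ 3) / (r - ρ) ^ 20 =
    C₃ * R ^ 19 / (r - ρ) ^ 20 * ∫ x in cubeAnnulus R, ‖U x‖ ^ 3 by ring]
  nlinarith [mul_le_mul_of_nonneg_right c2 hN2, mul_le_mul_of_nonneg_right c3 hN3]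

end StepData

/-- **Caccioppoli's inequality for smooth steady solutions on cubes** (Seregin–Wang 2020,
Prop. 2.1, (2.1), in the instance of the two Lebesgue norms `L²` and `L³` on the annulus and with
cubes in place of balls): there is an absolute constant `C` such that for every `ν > 0`,
`R > 0` and every smooth solution of `−νΔU + (U·∇)U + ∇P = 0`, `div U = 0` on `ℝ³`,
`ν ∫_{cube R/2} |∇U|² ≤ C (ν R⁻² ∫_{A_R} |U|² + R⁻¹ ∫_{A_R} |U|³)`,
`A_R = {R/2 ≤ maxᵢ|xᵢ| ≤ 4R/7} ⊆ B_R ∖ B_{R/2}`. [cite: SereginWang2020, Prop. 2.1 (2.1)] -/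
theorem caccioppoli : ∃ C : ℝ, 0 < C ∧ ∀ (ν R : ℝ) (U : ℝ³ → ℝ³) (P : ℝ³ → ℝ), 0 < ν → 0 < R →
    IsLerayProfile ν 0 U P → ContDiff ℝ ∞ U →
      ν * ∫ x in cube (R / 2), gradSq U x ≤
        C * (ν / R ^ 2 * (∫ x in cubeAnnulus R, ‖U x‖ ^ 2) + 1 / R * ∫ x in cubeAnnulus R, ‖U x‖ ^ 3) := by
  obtain ⟨Ca, hCa, habs⟩ := absorb_of_le_mul_add_div_pow (θ := 1 / 2) (by norm_num) (by norm_num) 20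
  refine ⟨Ca * 14 ^ 20 * (C₂ + C₃), by have := C₂_pos; have := C₃_pos; positivity, ?_⟩
  intro ν R U P hν hR hUP hU
  set N2 := ∫ x in cubeAnnulus R, ‖U x‖ ^ 2 with hN2
  set N3 := ∫ x in cubeAnnulus R, ‖U x‖ ^ 3 with hN3
  have hN2n : 0 ≤ N2 := integral_nonneg fun x => by positivity
  have hN3n : 0 ≤ N3 := integral_nonneg fun x => by positivity
  set K := ν * C₂ * R ^ 18 * N2 + C₃ * R ^ 19 * N3 with hK
  have hKn : 0 ≤ K := by have := C₂_pos; have := C₃_pos; positivity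
  have hstep : ∀ ρ' r', R / 2 ≤ ρ' → ρ' < r' → r' ≤ 4 * R / 7 →
      StepData ν R ρ' r' U P := fun ρ' r' h1 h2 h3 => ⟨hν, hR, h1, h2, h3, hUP, hU⟩
  have s₀ : StepData ν R (R / 2) (4 * R / 7) U P := hstep _ _ le_rfl (by linarith) le_rfl
  have h := habs (F ν U) (R / 2) (4 * R / 7) K (F ν U (4 * R / 7)) (by linarith) hKn
    (fun t _ => s₀.F_nonneg t) (fun t ht => s₀.F_mono ht.2)
    (fun ρ' r' h1 h2 h3 => (hstep ρ' r' h1 h2 h3).recursion)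
  have e : Ca * K / (4 * R / 7 - R / 2) ^ 20 = Ca * 14 ^ 20 * (ν * C₂ * (N2 / R ^ 2) + C₃ * (N3 / R)) := by
    rw [hK]; field_simp; ring
  rw [e] at h
  refine h.trans ?_
  have hC₂ := C₂_pos; have hC₃ := C₃_pos
  have e2 : Ca * 14 ^ 20 * (C₂ + C₃) * (ν / R ^ 2 * N2 + 1 / R * N3) =
      Ca * 14 ^ 20 * ((C₂ + C₃) * (ν * (N2 / R ^ 2)) + (C₂ + C₃) * (N3 / R)) := by ring
  rw [e2]
  refine mul_le_mul_of_nonneg_left (add_le_add ?_ ?_) (by positivity)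
  · have : 0 ≤ ν * (N2 / R ^ 2) := by positivity
    nlinarith
  · have : 0 ≤ N3 / R := by positivity
    nlinarith

end Assembly

end SteadyCaccioppoli

end Literature.Analysis.FluidPDE

end
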